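import Summits.MatrixMultiplication.MatrixMultiplication.Theses.LevelGradedCohnUmans
import Literature.RepresentationTheory.FiniteGroups.IrreducibleCharacters
import Literature.RepresentationTheory.FiniteGroups.WedderburnBlocks
import Summits.MatrixMultiplication.MatrixMultiplication.Theorems.LevelGradedCohnUmansGradedPricingStubExpansion
import Summits.MatrixMultiplication.MatrixMultiplication.Theorems.SubgroupIdentityDesigns.Negative.TorusCube

/-!
# Disproof work file for the crux `SubgroupIdentityDesigns` (stmt-MatrixMultiplication-14079)

Standing adversary file (cdisprove seats `refuter-cdisprove-stmt-MatrixMultiplication-14079-0` (gen 1, v1–v3)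
and `…-14079-g2-0` (gen 2, v4)).  Prose lives in docstrings; every `theorem` is kernel-checked (rc 0, no
`sorry`) unless it sits in the final `NearMisses` section (currently empty).

## v4 (gen 2, 2026-08-16) — what is new
* Line status: the lead's picked line `SketchIdeator3G2` (witnessed four-fold TPP, `f = 1_{Q_{a,b}}`) and the merged
  radial branch are DEAD by the lead's own verdict (`Lines/SketchIdeator3G2Dead.md`: hostless transfer stub
  `stub_witnessedOrSparse`; all technical stubs landed).  No stuck stubs are handed to this seat.
* `PairIndependence` / `CruxPairs` (abstract forms landed: `Negative/PairIndependence.lean`, p115936):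
  SLAB SUPPORT (`annihilator_vanishes_on_slab`: every level-`k` annihilator supported on `P = H₁H₂H₃`
  vanishes on `H₁·1·H₃`; dual form of the test), PAIR INDEPENDENCE (`outer/left/right_pair_independent`:
  `H₁H₃`, `H₁H₂`, `H₂H₃` are `F_k`-independent — `F_k` restricted to each is everything; the
  `|Hᵢ||Hⱼ| × N_k` character matrices `[ψ(tr(M x))]` have full row rank), the TENSOR CIRCUIT
  (`no_idTest_of_pair_circuit`: if `Σ_{a,c} θ₁(a)θ₃(c)ψ(tr(M ac)) = 0` for all `rk M ≤ k` and `θ₁(1)θ₃(1) ≠ 0`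
  then NO middle group works) and the MIDDLE CRITERION (`mid_criterion`, M11: a bi-`H₁×H₃`-invariant level-`k`
  function reads `δ_1` on `H₂` — a `|H₂|`-unknown linear system, the census' cheap exact filter).
* `TopLevel` (landed: `Negative/TopLevel.lean`, p116037): for `k ≥ m` EVERY function has level `k`
  (`levelSet_eq_univ_of_le`, Fourier inversion `Σ_M ψ(tr(MD)) = p^{m²}[D=0]`), the identity test is FREE
  (`idTest_of_le`, no TPP needed) and the budget is the FULL `Σ_{Irr} χ(1)^s` (`budget_of_le`); so the
  `k ≥ m` slice of the crux is literally the classical ungraded subgroup Cohn–Umans question in `GL_m(𝔽_p)`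
  (`topLevel_slice_iff`) under the tree's `SubgroupTPP.center_barrier_nat` (`vol_sq_mul_center_le`:
  `V²|Z| ≤ |G|³`).  A witness of the crux proper has `1 ≤ k < m`, `m ≥ 2`.
* `Negative/EnvelopeCount.lean` (p116725): every probe count holds against `dim F_k|_E` for any envelope
  `E` of the certified points (`card_le_finrank_restrict_of_triangular`, outer wall
  `|H₁||H₃| ≤ dim F_k|_E` for `E ⊇ H₁H₃`), e.g. `E = ⟨H₁,H₂,H₃⟩`: for envelopes `S ⊇ SL_m(𝔽_p)` the space
  `F_k|_S` misses the CUSPIDAL part of `ℂ[S]` (no invariants under unipotent radicals ⊂ `Fix(W)`), so a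
  product set that nearly fills such an `S` cannot carry the test (the dual criterion needs the cuspidal
  projection of `δ_1` to be matched from the few points of `S ∖ P`).
* `Reduction`: `not_subgroupIdentityDesigns_of` — `¬ crux` would follow from `VolumeLeDimConjecture`
  (`k < m ⇒ V ≤ dim F_k`, gen 1's conjecture) plus `NoTopLevelDesignAt ε` for ONE `0 < ε ≤ 1`.  **v6: the first
  hypothesis is FALSE** — the exhaustive censuses of this seat found subgroup identity designs with `V > dim F_k` at
  `(m,p,k) = (2,5,1)` (`V = 160 > 134`, 8 configurations) and `(3,2,2)` (`241` configurations, `V` up to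
  `288 > 150 > |G| = 168`), re-verified from the generators against the Fourier definition (evidence
  `evidence-VgtD-witnesses.md`).  The theorem stays (an implication), the route to a cheap universal kill is CLOSED.
* CENSUS, level 1 in `GL_2(𝔽_p)` (this seat; exact linear algebra mod two large primes, pure python in the
  seat + kit jobs j018913/j018965/j019055/j019056 for `GL_2(𝔽_{7,11})`, `GL_3(𝔽_{2,3})`, `GL_4(𝔽_2)` at all
  levels `k < m`, folded in when delivered):
  - THREE-BOREL family `(U⁻μ₁, U''μ₂, U⁺μ₃)` (`U''` = unipotent radical of a third Borel; TPP iff the torus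
    decorations avoid `SL_2` in the pattern `μ ∩ SL_2 = 1`; passes every count and TorusCube;
    `V = |μ₁||μ₂||μ₃| p³`): the level-1 identity test FAILS for EVERY decoration of order `≤ p+1` allowed by
    the walls at `p = 3, 5, 7` (kit j018965: 16 + 116 + 525 TPP triples incl. pure-torus middles, 0 pass) and
    for all 1295 further TPP triples reached at `p = 11, 13` (partial sweep): of the 1952 recorded triples every one
    passing the proven filters FAILS the full test or already the cheap M11 criterion — 0 survivors — even the bare `(U⁻, U'', U⁺)` with `V = p³ < D` fails
    (`|P| = p³ − p² + p`, `dim F_1|_P = 17, 77, 205` at `p = 3, 5, 7`).  Mechanism: `P ⊆ SL_2(𝔽_p)` misses only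
    the `p(p−2)` points `{g₁₁ = 0} ∖ {[[0,1],[−1,z]]}` of `SL_2`, while `dim F_1|_{SL_2} = |SL_2| − Σ_{discrete
    series} d² = 1 + p² + (p+1)²(p−2)/2`.  SHARPER (torus reduction, checked at `p = 5`): for outer pieces
    `H₁ ⊇ U⁻`, `H₃ ⊇ U⁺` the `(ψ_ξ, ψ_η)`-isotypic component (`ξη ≠ 0`) of a level-1 test is a
    `U⁻ × U⁺`-equivariant function, determined on the big cell by its torus values `φ(d)`, and
    `dim (F_1)_{ξ,η} = p − 1` (one Whittaker line per generic `ρ ∈ R_1 = {St, π(1,θ)}`); the slabs force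
    `φ = 0` on `μ₁·{d_b : b ∈ H₂ ∖ 1 big-cell torus parts}·μ₃` and `φ(1) ≠ 0`.  For the three-Borel family
    `d_{n(s)} = diag(1+s, (1+s)⁻¹)` exhausts the split torus of `SL_2`, and the forced big-cell function
    `[g₁₁ = 1] ψ(ξ g₂₁ + η g₁₂)` is NOT of level 1 for any `ξη ≠ 0` (`p = 5`: verified for all 16 pairs; it pairs
    non-trivially with discrete-series Bessel functions — a Kloosterman-type sum), which is the conceptual
    reason the family dies at every `p`.
  - KIT CENSUSES (bare-GAP lattices, j019269/j019270; exhaustive unless noted; `V > D_k`, surviving walls +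
    permutability counts; full test exact mod two primes): `GL_2(𝔽_3)` L1: 0/141; `GL_3(𝔽_2)` L1 (`D = 37`): 0/4207;
    `GL_2(𝔽_7)` L1: 0/1697 (partial); BUT `GL_2(𝔽_5)` L1 (`D = 134`): **8/23972 PASS**, all with `V = 160`, `|P| = 100`,
    shapes `(C₂,C₄,5:4)`, `(C₄,C₂,5:4)`, `(C₄,C₄,5:2)` — e.g. `H₁ = {diag(τ,1)}`, `H₂ = ⟨[[4,0],[1,1]]⟩`,
    `H₃ = ⟨[[0,1],[4,2]],[[1,3],[0,4]]⟩` (rows, right action); and `GL_3(𝔽_2)` L2 (`D = 150`): **241/1016 PASS** with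
    `168 ≤ V ≤ 288` (`V = 288`: `(S₃, C₄, A₄)`), all with `|P| ≤ 147 < D`, three of them non-trivial
    (`dim F_2|_P = |P| − 1`).  So gen-1's conjecture "`k < m ⇒ V ≤ dim F_k`" is FALSE, at the universality level `(2,1)`
    for odd `p` and at `(3,2,2)`.  EVERY pass found is a COINCIDENCE DESIGN: `V > |P|` (the product map is far from
    injective — the subgroup TPP allows it, as in `S₃` with `V = 8 > 6`), `|P| < D`, and `F_k|_P = ℂ^P` (or codimension 1).
    Pending censuses (j019471/j019472): `GL_2(𝔽_{7,11})` L1, `GL_3(𝔽_3)` L1–2, `GL_4(𝔽_2)` L1–3.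

## Verdict so far

No kill of the CRUX (an `∀ε ∃(p,m,k,H₁,H₂,H₃)` statement; an honest `¬` is a new graded packing
barrier for subgroup designs, unknown on paper).  But the ONLY CANDIDATE LINE on the item — the Borel
template of card `borel-configuration-identity-test` (`H₁ = S₁⋉U⁻_{cols≤k}`, `H₂ = S₂⋉U⁺_{rows k+1..2k}`,
`H₃ = S₃⋉U⁺_{rows≤k}` in `GL_{k²+3k/2}(𝔽_p)`) — is DEAD for every `k, m, p` by a theorem of this file,
the **graded normalizer count** (`volume_le_card_rankLE_of_le_normalizer`, abstract form landed as
`Theorems/SubgroupIdentityDesigns/Negative/GradedNormalizerCount.lean`):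

> TPP + identity test in a bi-invariant `J` ⇒ `|H₁| · |H₂ ∩ N_G(H₃)| · |H₃| ≤ dim J` and
> `|H₁| · |N_G(H₁) ∩ H₂| · |H₃| ≤ dim J`.

In the template `H₂ ≤ N_G(H₃)` (`U⁺_{rows≤k} ⊴ B⁺ ∋ H₂`; `S₂, S₃` diagonal; `U⁺_{rows k+1..2k}`
commutes with `S₃`, whose non-trivial coordinates are `≤ k`), so its volume would have to satisfy
`V ≤ dim F_k ≤ N_k = #{M : rk M ≤ k} ≈ p^{2mk−k²}`, against the card's `V = Θ(N_k^{3/2}/p)`: the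
identity test `Id ∉ span π_k(H₁H₂H₃ ∖ 1)` FAILS.  The same count kills every configuration whose
middle group normalises an outer group — `(U⁻, T, U⁺)`-type triples below the top level, the card's
`(6,2)` pattern configuration (`T ≤ H₂` normalises `U_{R₃}`), the kit datum `(Aff⁺, T₂, U⁻)` ✗
(`T₂ ⊂ N(U⁻)`: `p²(p−1)² > p³+p²−3p−1`) while allowing `(S₁U⁻, 1, U⁺)` ✓ (`p²(p−1) ≤ p³+p²−3p−1`),
both consistent with job j008119.

## Findings (index)
* `subgroupIdentityDesigns_iff` — the crux unfolds by `Iff.rfl` to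
  `SubgroupTPP ∧ IdTest k H₁ H₂ H₃ ∧ budget p m k (2+ε) < vol ^ ((2+ε)/3)` in this file's vocabulary.
* `one_le_budget`, `one_le_vol` — budget `≥ 1` (trivial character = rank-0 mode), volume `≥ 1`.
* `not_subgroupIdentityDesigns_levelZero`, `not_subgroupIdentityDesigns_rankZeroMatrices`,
  `not_subgroupIdentityDesigns_matOne` — STRENGTHENINGS REFUTED: the slices `k = 0` (constants test
  nothing: `H₁ = H₂ = H₃ = 1`), `m = 0`, and `m = 1` (abelian: `V ≤ |G| =` full budget) are false;
  every witness has `m ≥ 2`, `k ≥ 1`.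
* `withoutIdTest_holds`, `withoutTPP_holds` — LOAD-BEARING ANALYSIS: dropping the identity test
  (`k = 0`, `(⊤, 1, 1)` in `GL_1(𝔽_3)`) or dropping `SubgroupTPP` (`(⊤, ⊤, ⊤)` in `GL_1(𝔽_3)`, `k = 1`,
  `f = δ_1`) makes the statement TRIVIALLY TRUE for every `ε`: both hypotheses carry the weight.
* `levelSubmodule`, `levelSubmodule_biInv`, `finrank_levelSubmodule_le` — `F_k|_G` as a bi-invariant
  submodule of dimension `≤ N_k` (ported from the sibling seat's `Cruxes/LieRankDesigns/Disproof.lean`).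
* `card_mul_card_mul_card_le_finrank_of_conj_right/left` (abstract: `|H₁|·|K|·|H₃| ≤ dim J` for any
  `K ≤ H₂` conjugating `H₃` into the set `H₂H₃`, resp. `H₁` into `H₁H₂`),
  `card_mul_card_inf_normalizer_mul_card_le_finrank`, `card_mul_card_normalizer_inf_mul_card_le_finrank`
  (`K = H₂ ∩ N(H₃)`, `N(H₁) ∩ H₂`), `volume_le_finrank_of_perm` (`H₃H₂ ⊆ H₂H₃` or `H₂H₁ ⊆ H₁H₂` ⇒
  `V ≤ dim J`), `inf_normalizer_count`, `normalizer_inf_count` (crux form, `≤ N_k`) — THE GRADED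
  NORMALIZER / PERMUTABILITY COUNT (abstract part landed as `Negative/GradedNormalizerCount.lean`).
* `finrank_le_gradedBudget` — graded Plancherel: `dim J ≤ Σᶠ_{Irr ∩ J} χ(1)^s` for bi-invariant `J`,
  `s ≥ 2` (Wedderburn blocks + the `GradedPricing` line's `stub_support`/`stub_expansion`).
* `volume_le_card_rankLE_of_perm`, `vol_le_budget_of_perm`, `no_design_of_perm`,
  `volume_le_card_rankLE_of_le_normalizer`, `vol_le_budget_of_le_normalizer`,
  `no_design_of_le_normalizer`, `not_subgroupIdentityDesigns_of_le_normalizer` — if `H₂H₃` or `H₁H₂`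
  is a product-closed set (`H₃H₂ ⊆ H₂H₃`, e.g. a subgroup, e.g. `H₂ ≤ N(H₃)`; resp. `H₂H₁ ⊆ H₁H₂`) then
  `V ≤ dim F_k ≤ budget_s` for all `s ≥ 2`; no such design at any `ε ≤ 1`, and the `∀ε` sub-family
  of the crux with this side condition is FALSE.  (Template death; death of every Borel configuration
  whose middle and outer pieces permute.)
* `card_le_finrank_of_isolable`, `card_mul_card_le_finrank_of_stabilizers` (abstract, MASTER FORM; landed
  as `Negative/StabilizerCount.lean`), `stabilizer_count` (crux form) — for ANY tested set `S ∋ 1` with an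
  identity test in a bi-invariant `J`: #`{u⁻¹v⁻¹ : uSv ⊆ S} ≤ dim J`; subgroups `L, R` with `LS ⊆ S`,
  `SR ⊆ S`, `L ∩ R = 1` give `|L||R| ≤ dim J` (no TPP needed) — walls, normaliser/permutability counts
  and template death are the cases `(L,R) = (H₁,H₃), (H₁, K H₃), (H₁, H₂H₃)`.
* `card_le_finrank_of_triangular` (abstract; landed as `Negative/TriangularCount.lean`) — the common
  generalisation: any injective sequence `sᵢ` with pairs `(uᵢ,vᵢ)`, `uᵢsᵢvᵢ = 1`, `uᵢsⱼvᵢ ∈ S (j < i)` has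
  length `≤ dim J` (graded Neumann = points `ab, b ≠ 1` first, then the isolable `ac`); the CERTIFIED RANK
  of `H₁H₂H₃` is a linear-algebra-free necessary test (`≤ N_k`) for any candidate.
* `exists_idTest_volume_gt_finrank` — TIGHTNESS / the hypothesis is needed: in `S₃ ≅ GL_2(𝔽_2)` (top
  level, `J = ℂ^G`) the three transposition subgroups are a TPP triple with an identity test and
  `V = 8 > 6 = dim J = |G|`; so neither `V ≤ dim J` nor `V ≤ |G|` holds for general subgroup identity
  designs (correcting the batch note "subgroup TPP ⇒ V ≤ |G|"), and graded Neumann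
  `|H₁||H₃| + |H₁|(|H₂|−1) = 6 ≤ 6` is tight there.

## Numbers the provers should know
Combined count (triangular form; `K₁ := {b ∈ H₂ : b⁻¹H₁b ⊆ H₁H₂}`, `K₃ := {b ∈ H₂ : bH₃b⁻¹ ⊆ H₂H₃}`,
`ν := |K₁ ∪ K₃| ≥ |H₂ ∩ (N(H₁) ∪ N(H₃))|`): `ν|H₁||H₃| + |H₁|(|H₂| − ν) ≤ D` and
`ν|H₁||H₃| + (|H₂| − ν)|H₃| ≤ D` (`ν = 1` is graded Neumann); the extremal shape gives
`V ≤ 0.385 · D^{3/2}/√ν`.  The crux tolerates `ν ≤ p^{O(kε)}` as `k → ∞`, so it survives; but EVERY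
diagonal torus element, every element of a Borel containing `H₃`'s unipotent normal part, and every `b`
with `bH₃b⁻¹ ⊆ H₂H₃` is charged in full.  Level one, `GL_2(𝔽_p)` (kit j008119/j008501 of the card, all
five primes `p ≤ 13`): `(U⁻,T₁,U⁺)` separated (`V = p²(p−1) ≤ W`: allowed and tight-ish), `(U⁻,T,U⁺)` and
`(Aff⁺,T₂,U⁻)` not (`T ⊆ N(U^±)`: `p²(p−1)² > W = p³+p²−3p−1`) — both as this file predicts.
Kit jobs (this seat): j011435 (level-1 zoo in `GL_2(𝔽_p)`, `p ≤ 11`), j011437 (`GL_3` level 1,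
`GL_3(𝔽_2)` level 2, the card's `p = 2` skeleton in `GL_4(𝔽_2)` at levels 1–3); results are folded
into this docblock when delivered.

## F_k-STRUCTURAL obstruction (landed separately: `Negative/TorusCube.lean`, this seat)
TORUS-CUBE OBSTRUCTION (`no_idTest_of_torusCube`): for `k+1` coordinates `I₀`, the unitriangular block
`U_{I₀} ≅ U_{k+1}(𝔽_p)` on `I₀ × I₀` and a cube `{t_ε}` of DIAGONAL torus elements taking two distinct
non-zero values on each coordinate of `I₀` (one vertex equal to `1`): if `t_ε·U_{I₀} ⊆ S` for all `ε`
then NO level-`k` function is `δ_1` on `S` — because `λ = Σ_ε sgn(ε) 1_{t_ε U_{I₀}} ∈ F_k^⊥`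
(`ψ`-orthogonality on the pattern entries leaves only `M` upper triangular on `I₀` with non-zero diagonal
there, i.e. `rk M ≥ k+1`).  By bi-invariance the same holds for every two-sided translate / conjugate of
such a configuration inside `S = H₁H₂H₃`.  This is the Borel-template card's "torus rule" as a theorem and
the first constraint of the chain that uses the structure of `F_k` rather than `dim F_k`: a design's
product set carries split-torus rank `≤ k` along every embedded `U_{k+1}`-coset family (vacuous at
`p = 2`).  Zoo check (j011435, level 1 in `GL_2(𝔽_p)`, `p ≤ 11`, 93 triples): every prediction of the
counts holds (all `cnt > W` cases FAIL; torus middles normalising an outer group PASS iff `V ≤ W`: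
`(U⁻,S_i,U⁺)` ✓, `(U⁻,T,U⁺)`/`(S₁U^±,S₂,U^∓)` ✗), the rectangle rule explains every remaining failure of
`(U⁻μ_d, ⟨w⟩, U⁺μ'_{d'})` / `(U⁻μ_d, K¹_odd, U⁺μ'_{d'})` (FAIL iff `d, d' ≥ 2`), PASSing designs with a
non-trivial scattering middle exist (`(U⁻,C₃ ≤ K¹,U⁺)` at `p = 5, 11`; `(U⁻μ₂, C₃, U⁺)`, `V = 726`;
`(U⁻, gC₁₀g⁻¹, U⁺)`, `V = 1210` at `p = 11`) — and EVERY PASS HAS `V ≤ W`.  Conjecture recorded for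
the next cycle (would kill the crux at every `ε ≤ 1`): `k < m` ⇒ `|H₁||H₂||H₃| ≤ dim F_k` for every
subgroup identity design (false at the top level `k = m`: `S₃`); probe j014122 queued
(`(U⁻, C_m ≤ 𝔽_{p²}^×, U⁺)`, all `m | p²−1`, and `(U_col, Singer, U_row)` in `GL_3`).

## Round-1 idea cards on this crux versus the counts (read 2026-08-16T05:30Z)
* `anisotropic-siegel-sandwich` (GL_{2k}(𝔽_p): `H₁ = U_P⁻⋊(A₁'×1)`, `H₃ = (1×A₃'')⋉U_P`, twisted field-restriction
  middle `x·P_{k/2,k/2}(𝔽_{p²})·x⁻¹`, `|H₁||H₃| ≈ W(1 − k/p)`, `|H₂| ≈ W^{1/2}/p`): ALLOWED by every theorem here, and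
  wall-critical — `stabilizer_count` with `|H₁||H₃| > D/2` forces `Stab_L(H₁H₂H₃) = H₁`, `Stab_R = H₃` EXACTLY, and
  the permutability count forces `K₁ = K₃ = 1`, `H₂ ∩ N(H_i) = H₂ ∩ Z = 1` exactly (no slack at any `p > k+1`); so it
  is decided only by the identity test itself (its lab: level 2 in `GL_4(𝔽_3)`).  Its `GL_2` miniature
  `(U⁻, C_d, U⁺)`, `C_d ≤` norm-one torus, `d` odd: allowed (`ν = 1`, `p² + p(d−1) ≤ W`), far below the budget.
* `scattering-middle-normaliser-wall` / `overpacked-subgroup-footprints` (ideator 3; re-derives the normaliser count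
  independently, as does ideator 1): rank-defect criterion `r_k(S) − r_k(H₁(H₂∖1)H₃) = |H₁||H₃|` ⟺ identity test
  (consistent with `M = A₁A₃ ⊕ A₁A₂°A₃` here); their GAP census closes the level-1 subgroup cell of `GL_2(𝔽_p)`
  (p = 11 TPP-empty on admissible shapes, p = 13 survivors fail the middle test, p = 29 block test fails) — this
  seat's independent census j012916 (ν = |K₁ ∪ K₃| filter + full identity test) is queued for corroboration.

## Why it resists (for the provers) — the surviving design space after this file
A witness `(H₁,H₂,H₃)` at level `k` in `GL_m(𝔽_p)` must have, with `S = H₁H₂H₃`, `D = dim F_k ≤ N_k`: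
(1) walls `|H_i||H_j| ≤ D`; (2) graded Neumann `|H₁||H₃| + max(|H₁|,|H₃|)(|H₂|−1) ≤ D`;
(3) STABILIZERS: `|Stab_L(S)·Stab_R(S)| ≤ D` (`stabilizer_count`), so `[Stab_R(S) : H₃]`, `[Stab_L(S) : H₁]`
are `≤ D/|H₁||H₃| = p^{O(kε)}` for a near-extremal design: the middle group permutes with NEITHER
neighbour, meets NEITHER normaliser beyond `p^{O(kε)}`, and no subgroup `K ≤ H₂` of more than that size
conjugates `H₃` into `H₂H₃` or `H₁` into `H₁H₂`; (4) CERTIFIED RANK of `S` `≤ D` (`card_le_finrank_of_triangular`,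
computable without linear algebra over `F_k`); (5) the identity test itself.  Large subgroups of
`GL_m(𝔽_p)` live in parabolics and are normalised by tori, so (3) forces the three pieces into mutually
GENERIC position (three different parabolic types / conjugates), where no construction and no
computation of the identity test is currently available; conversely these counts alone cannot refute the
crux (at the top level `k = m` the `S₃` example has `V = 8 > 6 = D`, and the extremal Neumann shape has
certified rank `Θ(V^{2/3})`), so an honest `¬ SubgroupIdentityDesigns` needs `k < m` structure of `F_k`
(e.g. a graded mixing bound) — not available.  BARRIER-CANDIDATE for `Literature/Barriers/MatrixMultiplication/`:
"graded stabilizer barrier — subgroup (and coset-structured subset) designs priced at a graded budget pay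
`|Stab_L S · Stab_R S| ≤ dim J`".
GEN-2 ADDENDA (v4).  (6) `k < m` is forced (`TopLevel`: at `k ≥ m` the statement is the ungraded
subgroup Cohn–Umans problem of `GL_m(𝔽_p)`, to which BCGPU 2023 Cor 3.8 applies: `V² (p−1) ≤ |G|³`).
(7) PAIR INDEPENDENCE: each of `H₁H₃, H₁H₂, H₂H₃` is `F_k`-independent (full-row-rank character matrix),
and all annihilators on `S` live on the slabs `H₁(H₂∖1)H₃` — the dual form in which the test must be
decided; tensor circuits `θ₁ ⊗ θ₃` and the `|H₂|`-unknown middle system M11 are the cheap instances.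
(8) ENVELOPES: every count is against `dim F_k|_E`, `E ⊇` the certified points (`Negative/EnvelopeCount`);
pieces generating a small group `S = ⟨H₁,H₂,H₃⟩` pay against `dim F_k|_S`, which misses the cuspidal part of
`ℂ[S]` for `S ⊇ SL_m` — this is what kills the three-Borel family `(U⁻μ, U''μ'', U⁺μ')` of `GL_2(𝔽_p)`, the
one natural family passing (1)–(5) with `V > D`.  (9) DATA (v6): subgroup identity designs with `V > dim F_k` DO exist (`GL_2(𝔽_5)` L1: `V = 160 > 134`;
`GL_3(𝔽_2)` L2: `V ≤ 288 > 150`), all COINCIDENCE designs (`V > |P|`, `|P| < D`, `F_k|_P` (nearly) all of `ℂ^P`), none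
within a factor of `B₃` — so the graded regime has NO cheap universal kill of the form `V ≤ dim F_k`; what the data
still supports is `|P| ≲ dim F_k` for the product SET.  (10) A MECHANISM THE DATA SUGGESTS TO PROVERS (and the next thing
to attack for disprovers): pack `H₂ ∖ 1` into FEW `H₁–H₃` double cosets `H₁ b₀ H₃` with `b₀ ∉ H₁H₃` (the subgroup TPP only
forbids `H₂ ∩ H₁H₃ ≠ 1`), so that `|P| ≈ 2|H₁||H₃| ≲ D` while `V = |H₁||H₂||H₃|`; graded Neumann still caps
`|H₂| ≲ D/ max(|H₁|,|H₃|)`, i.e. `V ≲ 0.385 D^{3/2}` exactly at the extremal shape — coincidence designs are NOT excluded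
from the Neumann-extremal regime by any count of this file, and the identity test on a union of two double cosets is
the cheapest unsolved instance (`δ_1 ∈ F_k|_{H₁H₃ ⊔ H₁b₀H₃}`?).
-/

set_option linter.dupNamespace false

noncomputable section

open scoped BigOperators Classical
open Module Literature.RepresentationTheory.FiniteGroups Literature.Barriers.MatrixMultiplication

namespace Summit.MatrixMultiplication.MatrixMultiplication.Cruxes.SubgroupIdentityDesigns.Disproof

open Summit.MatrixMultiplication.MatrixMultiplication.Theses.LevelGradedCohnUmans
open Summit.MatrixMultiplication.MatrixMultiplication.Theorems.SubgroupIdentityDesigns.Negative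
  (sum_psi_mul stdAddChar_map_sum)

/-! ## Vocabulary (definitionally equal to the inlined clauses of the crux) -/

/-- `GL_m(𝔽_p)` as in the crux. -/
abbrev GLm (p m : ℕ) : Type := Matrix.GeneralLinearGroup (Fin m) (ZMod p)

/-- `M_m(𝔽_p)`, the Fourier side. -/
abbrev Mat (p m : ℕ) : Type := Matrix (Fin m) (Fin m) (ZMod p)

variable {p m : ℕ}

/-- The Fourier function `g ↦ Σ_M c_M ψ(tr(M g))` with coefficient table `c` (`ψ = ZMod.stdAddChar`). -/
def fourierFn [Fact p.Prime] (c : Mat p m → ℂ) (g : GLm p m) : ℂ :=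
  ∑ M : Mat p m, c M * ZMod.stdAddChar (Matrix.trace (M * (g : Mat p m)))

/-- "Fourier rank ≤ k": the coefficient table vanishes on matrices of rank `> k`. -/
def RankSupp [Fact p.Prime] (k : ℕ) (c : Mat p m → ℂ) : Prop :=
  ∀ M : Mat p m, k < M.rank → c M = 0

/-- The crux's IDENTITY TEST for a subgroup triple: ONE rank-`≤ k` Fourier function with `f 1 = 1`
and `f (a b g) = 0` whenever `a b g ≠ 1` (`a ∈ H₁, b ∈ H₂, g ∈ H₃`). Literally the second clause. -/
def IdTest [Fact p.Prime] (k : ℕ) (H₁ H₂ H₃ : Subgroup (GLm p m)) : Prop :=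
  ∃ c : Mat p m → ℂ, RankSupp k c ∧ fourierFn c 1 = 1 ∧
    ∀ a ∈ H₁, ∀ b ∈ H₂, ∀ g ∈ H₃, a * b * g ≠ 1 → fourierFn c (a * b * g) = 0

/-- The level-`k` test space `F_k` restricted to `GL_m(𝔽_p)` (as a set of functions). -/
def levelSet (p m : ℕ) [Fact p.Prime] (k : ℕ) : Set (GLm p m → ℂ) :=
  {f | ∃ c : Mat p m → ℂ, RankSupp k c ∧ ∀ g : GLm p m, f g = fourierFn c g}

/-- The graded budget `Σ_{χ ∈ Irr(GL_m(𝔽_p)) ∩ F_k} χ(1)^s`. -/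
def budget (p m : ℕ) [Fact p.Prime] (k : ℕ) (s : ℝ) : ℝ :=
  ∑ᶠ χ ∈ irrChars (GLm p m) ∩ levelSet p m k, (χ 1).re ^ s

/-- The volume `|H₁||H₂||H₃|` as a real number (cast of the natural number, as in the crux). -/
def vol (H₁ H₂ H₃ : Subgroup (GLm p m)) : ℝ := ((Nat.card H₁ * Nat.card H₂ * Nat.card H₃ : ℕ) : ℝ)

/-- The crux, restated in this vocabulary — by `Iff.rfl`, so nothing below drifts from the
statement as filed. -/
theorem subgroupIdentityDesigns_iff :
    SubgroupIdentityDesigns ↔ ∀ ε : ℝ, 0 < ε → ∃ (p : ℕ) (_ : Fact p.Prime) (m k : ℕ)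
      (H₁ H₂ H₃ : Subgroup (GLm p m)),
      SubgroupTPP H₁ H₂ H₃ ∧ IdTest k H₁ H₂ H₃ ∧ budget p m k (2 + ε) < vol H₁ H₂ H₃ ^ ((2 + ε) / 3) :=
  Iff.rfl

/-! ## The budget is never below 1 (trivial character); the volume is never below 1 -/

section Budget

variable [Fact p.Prime]

/-- The coefficient table of the constant function `1`: `δ_{M = 0}`. -/
def constCoeff (p m : ℕ) : Mat p m → ℂ := fun M => if M = 0 then 1 else 0

/-- The constant table is supported in rank `0 ≤ k`. [folklore] -/
theorem rankSupp_constCoeff (k : ℕ) : RankSupp (p := p) (m := m) k (constCoeff p m) := by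
  intro M hM
  unfold constCoeff
  split_ifs with h
  · subst h; simp at hM
  · rfl

/-- The Fourier function of the constant table is `1`. [folklore] -/
theorem fourierFn_constCoeff (g : GLm p m) : fourierFn (constCoeff p m) g = 1 := by
  unfold fourierFn constCoeff
  simp [Finset.sum_ite_eq']

/-- The trivial character of any group is the constant function `1`. -/
theorem character_trivial_apply {G : Type} [Group G] (g : G) :
    (Representation.trivial ℂ G ℂ).character g = 1 := by
  simp [Representation.character, Representation.trivial]

/-- The trivial character lies in every level `F_k` (it is the rank-`0` Fourier mode `M = 0`). -/
theorem trivial_mem_levelSet (k : ℕ) :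
    (Representation.trivial ℂ (GLm p m) ℂ).character ∈ irrChars (GLm p m) ∩ levelSet p m k :=
  ⟨character_trivial_mem_irrChars,
    ⟨constCoeff p m, rankSupp_constCoeff k, fun g => by
      rw [character_trivial_apply, fourierFn_constCoeff]⟩⟩

/-- Every irreducible character has `χ(1) = d ∈ ℕ`, so `(χ 1).re ≥ 0`. -/
theorem re_apply_one_nonneg {G : Type} [Group G] {χ : G → ℂ} (h : χ ∈ irrChars G) :
    0 ≤ (χ 1).re := by
  obtain ⟨d, -, hd⟩ := IsIrrChar.exists_apply_one h
  rw [hd]; simp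

/-- **The graded budget is at least `1`** for every level `k` and every real exponent `s`. -/
theorem one_le_budget (k : ℕ) (s : ℝ) : 1 ≤ budget p m k s := by
  classical
  unfold budget
  rw [finsum_mem_def]
  set S := irrChars (GLm p m) ∩ levelSet p m k with hS
  have hfin : (Function.support (S.indicator fun χ => (χ 1).re ^ s)).Finite :=
    ((irrChars_finite_holds (GLm p m)).subset Set.inter_subset_left).subset
      Set.support_indicator_subset
  have hnn : ∀ χ, 0 ≤ S.indicator (fun χ => (χ 1).re ^ s) χ := by
    intro χ
    by_cases hχ : χ ∈ S
    · rw [Set.indicator_of_mem hχ]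
      exact Real.rpow_nonneg (re_apply_one_nonneg hχ.1) s
    · rw [Set.indicator_of_notMem hχ]
  have h1 := single_le_finsum (Representation.trivial ℂ (GLm p m) ℂ).character hfin hnn
  rw [Set.indicator_of_mem (trivial_mem_levelSet k), character_trivial_apply] at h1
  simpa using h1

/-- Subgroups of a finite group have at least one element: `1 ≤ V`. -/
theorem one_le_vol_nat (H₁ H₂ H₃ : Subgroup (GLm p m)) :
    1 ≤ Nat.card H₁ * Nat.card H₂ * Nat.card H₃ := by
  have h1 : 0 < Nat.card H₁ := Nat.card_pos
  have h2 : 0 < Nat.card H₂ := Nat.card_pos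
  have h3 : 0 < Nat.card H₃ := Nat.card_pos
  exact Nat.mul_pos (Nat.mul_pos h1 h2) h3

/-- `1 ≤ V` as a real number. -/
theorem one_le_vol (H₁ H₂ H₃ : Subgroup (GLm p m)) : 1 ≤ vol H₁ H₂ H₃ := by
  unfold vol; exact_mod_cast one_le_vol_nat H₁ H₂ H₃

/-- For `ε ≤ 1`, `V^{(2+ε)/3} ≤ V` (as `V ≥ 1`). -/
theorem vol_rpow_le_vol {ε : ℝ} (hε1 : ε ≤ 1) (H₁ H₂ H₃ : Subgroup (GLm p m)) :
    vol H₁ H₂ H₃ ^ ((2 + ε) / 3) ≤ vol H₁ H₂ H₃ := by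
  conv_rhs => rw [← Real.rpow_one (vol H₁ H₂ H₃)]
  exact Real.rpow_le_rpow_of_exponent_le (one_le_vol H₁ H₂ H₃) (by linarith)

/-- **No design has `V = 1`**: then `V^{(2+ε)/3} = 1 ≤ budget`. -/
theorem not_lt_of_vol_eq_one {k : ℕ} {s e : ℝ} {H₁ H₂ H₃ : Subgroup (GLm p m)}
    (hV : Nat.card H₁ * Nat.card H₂ * Nat.card H₃ = 1) : ¬ budget p m k s < vol H₁ H₂ H₃ ^ e := by
  intro hlt
  unfold vol at hlt
  rw [hV, Nat.cast_one, Real.one_rpow] at hlt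
  exact absurd (one_le_budget (p := p) (m := m) k s) (not_le.mpr hlt)

end Budget

/-! ## Level `k = 0` is dead (constants test nothing) and `m = 0` is dead (trivial group) -/

section LevelZero

variable [Fact p.Prime]

/-- A nonzero matrix over a field has positive rank. -/
theorem rank_pos_of_ne_zero {M : Mat p m} (hM : M ≠ 0) : 0 < M.rank := by
  rw [Nat.pos_iff_ne_zero]
  intro h0
  apply hM
  have hbot : LinearMap.range M.mulVecLin = ⊥ := Submodule.finrank_eq_zero.mp h0
  ext i j
  have := LinearMap.range_eq_bot.mp hbot
  have hv : M.mulVecLin (Pi.single j 1) = 0 := by rw [this]; rfl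
  rw [Matrix.mulVecLin_apply, Matrix.mulVec_single_one] at hv
  exact congrFun hv i

/-- At level `0` every test function is constant (`= c 0`). -/
theorem fourierFn_const_of_rankSupp_zero {c : Mat p m → ℂ} (hc : RankSupp 0 c) (g : GLm p m) :
    fourierFn c g = c 0 := by
  classical
  unfold fourierFn
  rw [Finset.sum_eq_single (0 : Mat p m)]
  · simp
  · intro M _ hM
    rw [hc M (rank_pos_of_ne_zero hM), zero_mul]
  · intro h; exact absurd (Finset.mem_univ _) h

/-- **A level-`0` identity test forces the trivial triple**: `H₁ = H₂ = H₃ = 1`, so `V = 1`. -/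
theorem vol_eq_one_of_idTest_zero {H₁ H₂ H₃ : Subgroup (GLm p m)} (h : IdTest 0 H₁ H₂ H₃) :
    Nat.card H₁ * Nat.card H₂ * Nat.card H₃ = 1 := by
  obtain ⟨c, hc, h1, h0⟩ := h
  have hconst := fourierFn_const_of_rankSupp_zero hc
  rw [hconst] at h1
  -- every subgroup is trivial
  have htriv : ∀ (a b g : GLm p m), a ∈ H₁ → b ∈ H₂ → g ∈ H₃ → a * b * g = 1 := by
    intro a b g ha hb hg
    by_contra hne
    have := h0 a ha b hb g hg hne
    rw [hconst, h1] at this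
    exact one_ne_zero this
  have e1 : H₁ = ⊥ := (Subgroup.eq_bot_iff_forall _).2 fun a ha => by
    simpa using htriv a 1 1 ha H₂.one_mem H₃.one_mem
  have e2 : H₂ = ⊥ := (Subgroup.eq_bot_iff_forall _).2 fun b hb => by
    simpa using htriv 1 b 1 H₁.one_mem hb H₃.one_mem
  have e3 : H₃ = ⊥ := (Subgroup.eq_bot_iff_forall _).2 fun g hg => by
    simpa using htriv 1 1 g H₁.one_mem H₂.one_mem hg
  subst e1 e2 e3
  simp

end LevelZero

/-- **STRENGTHENING REFUTED (level `0`).**  The slice `k = 0` of `SubgroupIdentityDesigns` is false for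
every `ε`: a constant test with `f 1 = 1` vanishing on `H₁H₂H₃ ∖ 1` forces `H₁ = H₂ = H₃ = 1`, and then
`V^{(2+ε)/3} = 1 ≤ budget`.  Any proof of the crux must use Fourier modes of positive rank. -/
theorem not_subgroupIdentityDesigns_levelZero :
    ¬ (∀ ε : ℝ, 0 < ε → ∃ (p : ℕ) (_ : Fact p.Prime) (m : ℕ) (H₁ H₂ H₃ : Subgroup (GLm p m)),
        SubgroupTPP H₁ H₂ H₃ ∧ IdTest 0 H₁ H₂ H₃ ∧ budget p m 0 (2 + ε) < vol H₁ H₂ H₃ ^ ((2 + ε) / 3)) := by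
  intro h
  obtain ⟨p, hp, m, H₁, H₂, H₃, -, htest, hlt⟩ := h 1 one_pos
  exact not_lt_of_vol_eq_one (vol_eq_one_of_idTest_zero htest) hlt

/-- `GL_0` is the trivial group. [folklore] -/
instance : Subsingleton (GLm p 0) := by
  unfold GLm
  infer_instance

/-- **STRENGTHENING REFUTED (`m = 0`).**  `GL_0(𝔽_p)` is trivial, so `V = 1 ≤ budget`. -/
theorem not_subgroupIdentityDesigns_rankZeroMatrices :
    ¬ (∀ ε : ℝ, 0 < ε → ∃ (p : ℕ) (_ : Fact p.Prime) (k : ℕ) (H₁ H₂ H₃ : Subgroup (GLm p 0)),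
        SubgroupTPP H₁ H₂ H₃ ∧ IdTest k H₁ H₂ H₃ ∧ budget p 0 k (2 + ε) < vol H₁ H₂ H₃ ^ ((2 + ε) / 3)) := by
  intro h
  obtain ⟨p, hp, k, H₁, H₂, H₃, -, -, hlt⟩ := h 1 one_pos
  have hc : ∀ H : Subgroup (GLm p 0), Nat.card H = 1 := fun H =>
    Nat.card_eq_one_iff_unique.mpr ⟨⟨fun a b => Subtype.ext (Subsingleton.elim _ _)⟩, ⟨1⟩⟩
  exact not_lt_of_vol_eq_one (by rw [hc, hc, hc]) hlt

/-! ## `F_k|_G` as a bi-invariant submodule of dimension `≤ N_k`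
(ported from the sibling seat's `Cruxes/LieRankDesigns/Disproof.lean`) -/

section Level

variable [Fact p.Prime]

/-- Two-sided translate of a coefficient table: `transl a b c N = c (a⁻¹ N b⁻¹)`. -/
def transl (a b : GLm p m) (c : Mat p m → ℂ) : Mat p m → ℂ :=
  fun N => c (((a⁻¹ : GLm p m) : Mat p m) * N * ((b⁻¹ : GLm p m) : Mat p m))

/-- `M ↦ a M b` as a permutation of `M_m(𝔽_p)`. -/
def mulEquiv (a b : GLm p m) : Mat p m ≃ Mat p m where
  toFun M := (a : Mat p m) * M * (b : Mat p m)
  invFun N := ((a⁻¹ : GLm p m) : Mat p m) * N * ((b⁻¹ : GLm p m) : Mat p m)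
  left_inv M := by
    show ((a⁻¹ : GLm p m) : Mat p m) * ((a : Mat p m) * M * (b : Mat p m)) * ((b⁻¹ : GLm p m) : Mat p m) = M
    rw [Matrix.mul_assoc (a : Mat p m), Units.inv_mul_cancel_left, Units.mul_inv_cancel_right]
  right_inv N := by
    show (a : Mat p m) * (((a⁻¹ : GLm p m) : Mat p m) * N * ((b⁻¹ : GLm p m) : Mat p m)) * (b : Mat p m) = N
    rw [Matrix.mul_assoc ((a⁻¹ : GLm p m) : Mat p m), Units.mul_inv_cancel_left, Units.inv_mul_cancel_right]

/-- **`F_k` is bi-invariant**: translating the coefficient table realises `g ↦ f(b g a)`. -/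
theorem fourierFn_transl (a b : GLm p m) (c : Mat p m → ℂ) (g : GLm p m) :
    fourierFn (transl a b c) g = fourierFn c (b * g * a) := by
  unfold fourierFn transl
  rw [← Equiv.sum_comp (mulEquiv a b)]
  refine Finset.sum_congr rfl fun M _ => ?_
  simp only [mulEquiv, Equiv.coe_fn_mk]
  congr 1
  · congr 1
    rw [Matrix.mul_assoc (a : Mat p m), Units.inv_mul_cancel_left, Units.mul_inv_cancel_right]
  · congr 1
    rw [Units.val_mul, Units.val_mul,
      show (a : Mat p m) * M * (b : Mat p m) * (g : Mat p m) = (a : Mat p m) * (M * (b : Mat p m) * (g : Mat p m)) by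
        simp only [Matrix.mul_assoc],
      Matrix.trace_mul_comm]
    simp only [Matrix.mul_assoc]

/-- Two-sided multiplication by units preserves the rank. [folklore] -/
theorem rank_transl_arg (a b : GLm p m) (N : Mat p m) :
    (((a⁻¹ : GLm p m) : Mat p m) * N * ((b⁻¹ : GLm p m) : Mat p m)).rank = N.rank := by
  have ha : IsUnit (((a⁻¹ : GLm p m) : Mat p m)).det :=
    (Matrix.isUnit_iff_isUnit_det _).mp (Units.isUnit _)
  have hb : IsUnit (((b⁻¹ : GLm p m) : Mat p m)).det :=
    (Matrix.isUnit_iff_isUnit_det _).mp (Units.isUnit _)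
  rw [Matrix.rank_mul_eq_left_of_isUnit_det _ _ hb, Matrix.rank_mul_eq_right_of_isUnit_det _ _ ha]

/-- Translation preserves the rank support. [folklore] -/
theorem rankSupp_transl {k : ℕ} (a b : GLm p m) {c : Mat p m → ℂ} (hc : RankSupp k c) :
    RankSupp k (transl a b c) := fun N hN =>
  hc _ (by rwa [rank_transl_arg])

/-- The level set of functions is closed under two-sided translation. -/
theorem levelSet_transl {k : ℕ} {f : GLm p m → ℂ} (hf : f ∈ levelSet p m k) (a b : GLm p m) :
    (fun g => f (b * g * a)) ∈ levelSet p m k := by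
  obtain ⟨c, hc, hfc⟩ := hf
  exact ⟨transl a b c, rankSupp_transl a b hc, fun g => by simp only [hfc, fourierFn_transl]⟩

/-- Matrices of rank `≤ k` (the Fourier support of level `k`); `N_k := |RankLE p m k|`. -/
abbrev RankLE (p m k : ℕ) : Type := {M : Mat p m // M.rank ≤ k}

/-- Sum over all matrices of a rank-supported table = sum over the rank-`≤ k` ones. -/
theorem sum_eq_sum_rankLE {k : ℕ} {c : Mat p m → ℂ} (hc : RankSupp k c) (w : Mat p m → ℂ) :
    ∑ M : Mat p m, c M * w M = ∑ M : RankLE p m k, c M.1 * w M.1 := by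
  classical
  rw [← Finset.sum_filter_of_ne (p := fun M : Mat p m => M.rank ≤ k)
      (fun M _ hM => le_of_not_gt fun hlt => hM (by rw [hc M hlt, zero_mul]))]
  exact Finset.sum_subtype _ (by simp) _

/-- The coefficient-to-function map on rank-`≤ k` tables. -/
def levelMap (p m k : ℕ) [Fact p.Prime] : (RankLE p m k → ℂ) →ₗ[ℂ] (GLm p m → ℂ) where
  toFun c g := ∑ M : RankLE p m k, c M * ZMod.stdAddChar (Matrix.trace (M.1 * (g : Mat p m)))
  map_add' c c' := by
    funext g
    simp only [Pi.add_apply, add_mul, Finset.sum_add_distrib]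
  map_smul' r c := by
    funext g
    simp only [Pi.smul_apply, smul_eq_mul, RingHom.id_apply, Finset.mul_sum, mul_assoc]

/-- `F_k|_G` as a submodule of `ℂ^{GL_m(𝔽_p)}`. -/
def levelSubmodule (p m k : ℕ) [Fact p.Prime] : Submodule ℂ (GLm p m → ℂ) :=
  LinearMap.range (levelMap p m k)

variable {k : ℕ}

/-- The submodule and the set-level description agree. -/
theorem mem_levelSubmodule_iff {f : GLm p m → ℂ} : f ∈ levelSubmodule p m k ↔ f ∈ levelSet p m k := by
  classical
  constructor
  · rintro ⟨c', rfl⟩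
    have hsupp : RankSupp k (fun M : Mat p m => if h : M.rank ≤ k then c' ⟨M, h⟩ else 0) := by
      intro M hM; simp [not_le.mpr hM]
    refine ⟨_, hsupp, fun g => ?_⟩
    rw [fourierFn, sum_eq_sum_rankLE hsupp]
    simp only [levelMap, LinearMap.coe_mk, AddHom.coe_mk]
    refine Finset.sum_congr rfl fun M _ => ?_
    rw [dif_pos M.2]
  · rintro ⟨c, hc, hfc⟩
    refine ⟨fun M => c M.1, ?_⟩
    funext g
    rw [hfc g, fourierFn, sum_eq_sum_rankLE hc]
    rfl

/-- As sets, `levelSubmodule = levelSet` (so the crux's budget is the budget of `J = F_k|_G`). -/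
theorem coe_levelSubmodule : (levelSubmodule p m k : Set (GLm p m → ℂ)) = levelSet p m k :=
  Set.ext fun _ => mem_levelSubmodule_iff

/-- `dim F_k|_G ≤ N_k = #{M : rk M ≤ k}`. -/
theorem finrank_levelSubmodule_le :
    Module.finrank ℂ (levelSubmodule p m k) ≤ Fintype.card (RankLE p m k) := by
  have h := LinearMap.finrank_range_le (levelMap p m k)
  rwa [Module.finrank_fintype_fun_eq_card] at h

/-- **`F_k|_G` is BI-INVARIANT** in the two-sided form used by `GradedDesignFamily` / `GradedPricing`. -/
theorem levelSubmodule_biInv :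
    ∀ f ∈ levelSubmodule p m k, ∀ a b : GLm p m, (fun g => f (a * g * b)) ∈ levelSubmodule p m k := by
  intro f hf a b
  rw [mem_levelSubmodule_iff] at hf ⊢
  exact levelSet_transl hf b a

/-- The identity test, read as "some `f ∈ F_k|_G` is `δ_1` on `H₁H₂H₃`". -/
theorem idTest_iff {H₁ H₂ H₃ : Subgroup (GLm p m)} :
    IdTest k H₁ H₂ H₃ ↔ ∃ f ∈ levelSubmodule p m k, f 1 = 1 ∧
      ∀ a ∈ H₁, ∀ b ∈ H₂, ∀ g ∈ H₃, a * b * g ≠ 1 → f (a * b * g) = 0 := by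
  constructor
  · rintro ⟨c, hc, h1, h0⟩
    exact ⟨fourierFn c, mem_levelSubmodule_iff.2 ⟨c, hc, fun _ => rfl⟩, h1, h0⟩
  · rintro ⟨f, hf, h1, h0⟩
    obtain ⟨c, hc, hfc⟩ := mem_levelSubmodule_iff.1 hf
    exact ⟨c, hc, (hfc 1) ▸ h1, fun a ha b hb g hg hne => (hfc _) ▸ h0 a ha b hb g hg hne⟩

/-- The budget is a `finsum` over `Irr ∩ (F_k|_G : Set)`. -/
theorem budget_eq (s : ℝ) :
    budget p m k s = ∑ᶠ χ ∈ irrChars (GLm p m) ∩ (levelSubmodule p m k : Set (GLm p m → ℂ)), (χ 1).re ^ s := by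
  rw [coe_levelSubmodule]; rfl

end Level

/-! ## THE GRADED NORMALIZER COUNT (abstract form; landed as
`Theorems/SubgroupIdentityDesigns/Negative/GradedNormalizerCount.lean`) -/

section AbstractCount

variable {G : Type} [Group G]

/-- **Read-out.**  Under the subgroup TPP an identity test `f` (`f 1 = 1`, `f = 0` on
`H₁H₂H₃ ∖ {1}`) reads `f (x y z) = [x = 1 ∧ y = 1 ∧ z = 1]` for `x ∈ H₁, y ∈ H₂, z ∈ H₃`. -/
theorem idTest_apply_eq_ite {H₁ H₂ H₃ : Subgroup G} (htpp : SubgroupTPP H₁ H₂ H₃)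
    {f : G → ℂ} (h1 : f 1 = 1)
    (h0 : ∀ a ∈ H₁, ∀ b ∈ H₂, ∀ c ∈ H₃, a * b * c ≠ 1 → f (a * b * c) = 0)
    {x y z : G} (hx : x ∈ H₁) (hy : y ∈ H₂) (hz : z ∈ H₃) :
    f (x * y * z) = if x = 1 ∧ y = 1 ∧ z = 1 then 1 else 0 := by
  by_cases h : x * y * z = 1
  · obtain ⟨rfl, rfl, rfl⟩ := htpp x hx y hy z hz h
    simp [h1]
  · rw [h0 x hx y hy z hz h, if_neg]
    rintro ⟨rfl, rfl, rfl⟩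
    exact h (by simp)

/-- Under the subgroup TPP, `H₂ ∩ H₃ = 1`. [folklore] -/
theorem eq_one_of_mem_mid_right {H₁ H₂ H₃ : Subgroup G} (htpp : SubgroupTPP H₁ H₂ H₃)
    {t : G} (h2 : t ∈ H₂) (h3 : t ∈ H₃) : t = 1 := by
  have h := htpp 1 H₁.one_mem t⁻¹ (H₂.inv_mem h2) t h3 (by simp)
  exact h.2.2

/-- Under the subgroup TPP, `H₁ ∩ H₂ = 1`. [folklore] -/
theorem eq_one_of_mem_left_mid {H₁ H₂ H₃ : Subgroup G} (htpp : SubgroupTPP H₁ H₂ H₃)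
    {t : G} (h1 : t ∈ H₁) (h2 : t ∈ H₂) : t = 1 := by
  have h := htpp t h1 t⁻¹ (H₂.inv_mem h2) 1 H₃.one_mem (by simp)
  exact h.1

variable [Finite G]

/-- **GRADED PERMUTABILITY COUNT (right).**  For a bi-invariant `J ≤ ℂ^G`, a subgroup TPP triple, an
identity test `f ∈ J`, and a subgroup `K ≤ H₂` conjugating `H₃` into the product set `H₂H₃`:
`|H₁| · |K| · |H₃| ≤ dim J`.  Probes `g ↦ f (a⁻¹ g c⁻¹ b⁻¹)`, `(a,b,c) ∈ H₁ × K × H₃`, are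
biorthogonal to the evaluations at `a' b' c'`:
`a⁻¹ (a'b'c') c⁻¹ b⁻¹ = (a⁻¹a')(b'b⁻¹)(b(c'c⁻¹)b⁻¹) = (a⁻¹a')(b'b⁻¹y) z`. -/
theorem card_mul_card_mul_card_le_finrank_of_conj_right (J : Submodule ℂ (G → ℂ))
    (hJ : ∀ f ∈ J, ∀ a b : G, (fun g : G => f (a * g * b)) ∈ J)
    {H₁ H₂ H₃ : Subgroup G} (htpp : SubgroupTPP H₁ H₂ H₃)
    (K : Subgroup G) (hKH : K ≤ H₂)
    (hK : ∀ b ∈ K, ∀ h ∈ H₃, ∃ y ∈ H₂, ∃ z ∈ H₃, b * h * b⁻¹ = y * z)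
    {f : G → ℂ} (hf : f ∈ J) (h1 : f 1 = 1)
    (h0 : ∀ a ∈ H₁, ∀ b ∈ H₂, ∀ c ∈ H₃, a * b * c ≠ 1 → f (a * b * c) = 0) :
    Nat.card H₁ * Nat.card K * Nat.card H₃ ≤ Module.finrank ℂ J := by
  classical
  haveI : Fintype G := Fintype.ofFinite G
  -- the probes
  let w : ↥H₁ × ↥K × ↥H₃ → J := fun t =>
    ⟨fun g => f ((t.1 : G)⁻¹ * g * ((t.2.2 : G)⁻¹ * (t.2.1 : G)⁻¹)), hJ f hf _ _⟩
  -- biorthogonality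
  have hw : ∀ t s : ↥H₁ × ↥K × ↥H₃,
      (w t : G → ℂ) ((s.1 : G) * (s.2.1 : G) * (s.2.2 : G)) = if t = s then 1 else 0 := by
    rintro ⟨⟨a, ha⟩, ⟨b, hb⟩, ⟨c, hc⟩⟩ ⟨⟨a', ha'⟩, ⟨b', hb'⟩, ⟨c', hc'⟩⟩
    have hbH : b ∈ H₂ := hKH hb
    have hb'H : b' ∈ H₂ := hKH hb'
    obtain ⟨y, hy, z, hz, hyz⟩ := hK b hb (c' * c⁻¹) (H₃.mul_mem hc' (H₃.inv_mem hc))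
    have key : a⁻¹ * (a' * b' * c') * (c⁻¹ * b⁻¹) =
        (a⁻¹ * a') * (b' * b⁻¹) * (b * (c' * c⁻¹) * b⁻¹) := by group
    have hx : a⁻¹ * a' ∈ H₁ := H₁.mul_mem (H₁.inv_mem ha) ha'
    have hy' : b' * b⁻¹ * y ∈ H₂ := H₂.mul_mem (H₂.mul_mem hb'H (H₂.inv_mem hbH)) hy
    show f (a⁻¹ * (a' * b' * c') * (c⁻¹ * b⁻¹)) = _
    rw [key, hyz, show a⁻¹ * a' * (b' * b⁻¹) * (y * z) = a⁻¹ * a' * (b' * b⁻¹ * y) * z by group,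
      idTest_apply_eq_ite htpp h1 h0 hx hy' hz]
    -- the read-out condition is `t = s`
    have hiff : (a⁻¹ * a' = 1 ∧ b' * b⁻¹ * y = 1 ∧ z = 1) ↔ (a = a' ∧ b = b' ∧ c = c') := by
      constructor
      · rintro ⟨e1, e2, e3⟩
        subst e3
        rw [mul_one] at hyz
        -- `c' c⁻¹ = b⁻¹ y b ∈ H₂ ∩ H₃`
        have hcc : c' * c⁻¹ ∈ H₂ := by
          have : c' * c⁻¹ = b⁻¹ * y * b := by rw [← hyz]; group
          rw [this]
          exact H₂.mul_mem (H₂.mul_mem (H₂.inv_mem hbH) hy) hbH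
        have hc1 : c' * c⁻¹ = 1 :=
          eq_one_of_mem_mid_right htpp hcc (H₃.mul_mem hc' (H₃.inv_mem hc))
        have hy1 : y = 1 := by rw [hc1] at hyz; simpa using hyz.symm
        rw [hy1, mul_one, mul_inv_eq_one] at e2
        exact ⟨inv_mul_eq_one.1 e1, e2.symm, (mul_inv_eq_one.1 hc1).symm⟩
      · rintro ⟨rfl, rfl, rfl⟩
        rw [mul_inv_cancel, mul_one, mul_inv_cancel] at hyz
        obtain ⟨-, hy1, hz1⟩ := htpp 1 H₁.one_mem y hy z hz (by simpa using hyz.symm)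
        exact ⟨inv_mul_cancel a, by rw [hy1, mul_inv_cancel, mul_one], hz1⟩
    simp only [hiff, Prod.mk.injEq, Subtype.mk.injEq]
  -- linear independence of the probes
  have hli : LinearIndependent ℂ w := by
    rw [Fintype.linearIndependent_iff]
    intro g hg s
    have := congrArg (fun v : J => (v : G → ℂ) ((s.1 : G) * (s.2.1 : G) * (s.2.2 : G))) hg
    simpa [Submodule.coe_sum, Finset.sum_apply, hw, Finset.sum_ite_eq', Finset.mem_univ] using this
  have hcard : Fintype.card (↥H₁ × ↥K × ↥H₃) ≤ Module.finrank ℂ J := hli.fintype_card_le_finrank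
  rw [← Nat.card_eq_fintype_card, Nat.card_prod, Nat.card_prod] at hcard
  simpa [mul_assoc] using hcard

/-- **GRADED PERMUTABILITY COUNT (left).**  With `K ≤ H₂` conjugating `H₁` into `H₁H₂`
(`b⁻¹ h b ∈ H₁H₂`): `|H₁| · |K| · |H₃| ≤ dim J`, by the probes `g ↦ f (b⁻¹ a⁻¹ g c⁻¹)`:
`b⁻¹ a⁻¹ (a'b'c') c⁻¹ = (b⁻¹(a⁻¹a')b)(b⁻¹b')(c'c⁻¹) = x (y b⁻¹ b')(c'c⁻¹)`. -/
theorem card_mul_card_mul_card_le_finrank_of_conj_left (J : Submodule ℂ (G → ℂ))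
    (hJ : ∀ f ∈ J, ∀ a b : G, (fun g : G => f (a * g * b)) ∈ J)
    {H₁ H₂ H₃ : Subgroup G} (htpp : SubgroupTPP H₁ H₂ H₃)
    (K : Subgroup G) (hKH : K ≤ H₂)
    (hK : ∀ b ∈ K, ∀ h ∈ H₁, ∃ x ∈ H₁, ∃ y ∈ H₂, b⁻¹ * h * b = x * y)
    {f : G → ℂ} (hf : f ∈ J) (h1 : f 1 = 1)
    (h0 : ∀ a ∈ H₁, ∀ b ∈ H₂, ∀ c ∈ H₃, a * b * c ≠ 1 → f (a * b * c) = 0) :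
    Nat.card H₁ * Nat.card K * Nat.card H₃ ≤ Module.finrank ℂ J := by
  classical
  haveI : Fintype G := Fintype.ofFinite G
  let w : ↥H₁ × ↥K × ↥H₃ → J := fun t =>
    ⟨fun g => f (((t.2.1 : G)⁻¹ * (t.1 : G)⁻¹) * g * (t.2.2 : G)⁻¹), hJ f hf _ _⟩
  have hw : ∀ t s : ↥H₁ × ↥K × ↥H₃,
      (w t : G → ℂ) ((s.1 : G) * (s.2.1 : G) * (s.2.2 : G)) = if t = s then 1 else 0 := by
    rintro ⟨⟨a, ha⟩, ⟨b, hb⟩, ⟨c, hc⟩⟩ ⟨⟨a', ha'⟩, ⟨b', hb'⟩, ⟨c', hc'⟩⟩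
    have hbH : b ∈ H₂ := hKH hb
    have hb'H : b' ∈ H₂ := hKH hb'
    obtain ⟨x, hx, y, hy, hxy⟩ := hK b hb (a⁻¹ * a') (H₁.mul_mem (H₁.inv_mem ha) ha')
    have key : b⁻¹ * a⁻¹ * (a' * b' * c') * c⁻¹ =
        (b⁻¹ * (a⁻¹ * a') * b) * (b⁻¹ * b') * (c' * c⁻¹) := by group
    have hy' : y * (b⁻¹ * b') ∈ H₂ := H₂.mul_mem hy (H₂.mul_mem (H₂.inv_mem hbH) hb'H)
    have hz : c' * c⁻¹ ∈ H₃ := H₃.mul_mem hc' (H₃.inv_mem hc)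
    show f (b⁻¹ * a⁻¹ * (a' * b' * c') * c⁻¹) = _
    rw [key, hxy, show x * y * (b⁻¹ * b') * (c' * c⁻¹) = x * (y * (b⁻¹ * b')) * (c' * c⁻¹) by group,
      idTest_apply_eq_ite htpp h1 h0 hx hy' hz]
    have hiff : (x = 1 ∧ y * (b⁻¹ * b') = 1 ∧ c' * c⁻¹ = 1) ↔ (a = a' ∧ b = b' ∧ c = c') := by
      constructor
      · rintro ⟨e1, e2, e3⟩
        subst e1
        rw [one_mul] at hxy
        -- `a⁻¹ a' = b y b⁻¹ ∈ H₁ ∩ H₂`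
        have haa : a⁻¹ * a' ∈ H₂ := by
          have : a⁻¹ * a' = b * y * b⁻¹ := by rw [← hxy]; group
          rw [this]
          exact H₂.mul_mem (H₂.mul_mem hbH hy) (H₂.inv_mem hbH)
        have ha1 : a⁻¹ * a' = 1 :=
          eq_one_of_mem_left_mid htpp (H₁.mul_mem (H₁.inv_mem ha) ha') haa
        have hy1 : y = 1 := by rw [ha1] at hxy; simpa using hxy.symm
        rw [hy1, one_mul, inv_mul_eq_one] at e2
        exact ⟨inv_mul_eq_one.1 ha1, e2, (mul_inv_eq_one.1 e3).symm⟩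
      · rintro ⟨rfl, rfl, rfl⟩
        rw [inv_mul_cancel, mul_one, inv_mul_cancel] at hxy
        obtain ⟨hx1, hy1, -⟩ := htpp x hx y hy 1 H₃.one_mem (by simpa using hxy.symm)
        exact ⟨hx1, by rw [hy1, inv_mul_cancel, mul_one], mul_inv_cancel c⟩
    simp only [hiff, Prod.mk.injEq, Subtype.mk.injEq]
  have hli : LinearIndependent ℂ w := by
    rw [Fintype.linearIndependent_iff]
    intro g hg s
    have := congrArg (fun v : J => (v : G → ℂ) ((s.1 : G) * (s.2.1 : G) * (s.2.2 : G))) hg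
    simpa [Submodule.coe_sum, Finset.sum_apply, hw, Finset.sum_ite_eq', Finset.mem_univ] using this
  have hcard : Fintype.card (↥H₁ × ↥K × ↥H₃) ≤ Module.finrank ℂ J := hli.fintype_card_le_finrank
  rw [← Nat.card_eq_fintype_card, Nat.card_prod, Nat.card_prod] at hcard
  simpa [mul_assoc] using hcard

/-- **GRADED NORMALIZER COUNT (right)**: `|H₁| · |H₂ ∩ N_G(H₃)| · |H₃| ≤ dim J` — the case
`K = H₂ ∩ N(H₃)` (`b h b⁻¹ ∈ H₃ = 1 · H₃`).  Graded form of BCGPU 2023 Thm 3.6 (`|G| ↦ dim J`). -/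
theorem card_mul_card_inf_normalizer_mul_card_le_finrank (J : Submodule ℂ (G → ℂ))
    (hJ : ∀ f ∈ J, ∀ a b : G, (fun g : G => f (a * g * b)) ∈ J)
    {H₁ H₂ H₃ : Subgroup G} (htpp : SubgroupTPP H₁ H₂ H₃)
    {f : G → ℂ} (hf : f ∈ J) (h1 : f 1 = 1)
    (h0 : ∀ a ∈ H₁, ∀ b ∈ H₂, ∀ c ∈ H₃, a * b * c ≠ 1 → f (a * b * c) = 0) :
    Nat.card H₁ * Nat.card ↥(H₂ ⊓ Subgroup.normalizer (H₃ : Set G)) * Nat.card H₃ ≤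
      Module.finrank ℂ J :=
  card_mul_card_mul_card_le_finrank_of_conj_right J hJ htpp _ inf_le_left
    (fun b hb h hh => ⟨1, H₂.one_mem, b * h * b⁻¹,
      (Subgroup.mem_normalizer_iff.1 (Subgroup.mem_inf.1 hb).2 h).1 hh, by rw [one_mul]⟩) hf h1 h0

/-- **GRADED NORMALIZER COUNT (left)**: `|H₁| · |N_G(H₁) ∩ H₂| · |H₃| ≤ dim J` — the case
`K = N(H₁) ∩ H₂` (`b⁻¹ h b ∈ H₁ = H₁ · 1`). -/
theorem card_mul_card_normalizer_inf_mul_card_le_finrank (J : Submodule ℂ (G → ℂ))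
    (hJ : ∀ f ∈ J, ∀ a b : G, (fun g : G => f (a * g * b)) ∈ J)
    {H₁ H₂ H₃ : Subgroup G} (htpp : SubgroupTPP H₁ H₂ H₃)
    {f : G → ℂ} (hf : f ∈ J) (h1 : f 1 = 1)
    (h0 : ∀ a ∈ H₁, ∀ b ∈ H₂, ∀ c ∈ H₃, a * b * c ≠ 1 → f (a * b * c) = 0) :
    Nat.card H₁ * Nat.card ↥(Subgroup.normalizer (H₁ : Set G) ⊓ H₂) * Nat.card H₃ ≤
      Module.finrank ℂ J :=
  card_mul_card_mul_card_le_finrank_of_conj_left J hJ htpp _ inf_le_right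
    (fun b hb h hh => by
      have hbN : b⁻¹ ∈ Subgroup.normalizer (H₁ : Set G) :=
        Subgroup.inv_mem _ (Subgroup.mem_inf.1 hb).1
      have hmem := (Subgroup.mem_normalizer_iff.1 hbN h).1 hh
      rw [inv_inv] at hmem
      exact ⟨b⁻¹ * h * b, hmem, 1, H₂.one_mem, by rw [mul_one]⟩) hf h1 h0

/-- **The whole volume is charged when the middle group PERMUTES with an outer one.**  If
`H₃H₂ ⊆ H₂H₃` (equivalently `H₂H₃` is a subgroup; e.g. `H₂ ≤ N(H₃)`) or `H₂H₁ ⊆ H₁H₂`, then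
`|H₁| |H₂| |H₃| ≤ dim J`. -/
theorem volume_le_finrank_of_perm (J : Submodule ℂ (G → ℂ))
    (hJ : ∀ f ∈ J, ∀ a b : G, (fun g : G => f (a * g * b)) ∈ J)
    {H₁ H₂ H₃ : Subgroup G} (htpp : SubgroupTPP H₁ H₂ H₃)
    (hperm : (∀ z ∈ H₃, ∀ y ∈ H₂, ∃ y' ∈ H₂, ∃ z' ∈ H₃, z * y = y' * z') ∨
      (∀ y ∈ H₂, ∀ x ∈ H₁, ∃ x' ∈ H₁, ∃ y' ∈ H₂, y * x = x' * y'))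
    {f : G → ℂ} (hf : f ∈ J) (h1 : f 1 = 1)
    (h0 : ∀ a ∈ H₁, ∀ b ∈ H₂, ∀ c ∈ H₃, a * b * c ≠ 1 → f (a * b * c) = 0) :
    Nat.card H₁ * Nat.card H₂ * Nat.card H₃ ≤ Module.finrank ℂ J := by
  rcases hperm with hperm | hperm
  · refine card_mul_card_mul_card_le_finrank_of_conj_right J hJ htpp H₂ le_rfl
      (fun b hb h hh => ?_) hf h1 h0
    obtain ⟨y', hy', z', hz', he⟩ := hperm h hh b⁻¹ (H₂.inv_mem hb)
    exact ⟨b * y', H₂.mul_mem hb hy', z', hz', by rw [mul_assoc, he, ← mul_assoc]⟩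
  · refine card_mul_card_mul_card_le_finrank_of_conj_left J hJ htpp H₂ le_rfl
      (fun b hb h hh => ?_) hf h1 h0
    obtain ⟨x', hx', y', hy', he⟩ := hperm b⁻¹ (H₂.inv_mem hb) h hh
    exact ⟨x', hx', y' * b, H₂.mul_mem hy' hb, by rw [he, mul_assoc]⟩

/-- **The whole volume is charged when the middle group NORMALISES an outer one.**  If
`H₂ ≤ N_G(H₃)` or `H₂ ≤ N_G(H₁)`, then `|H₁| |H₂| |H₃| ≤ dim J`. -/
theorem volume_le_finrank_of_le_normalizer (J : Submodule ℂ (G → ℂ))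
    (hJ : ∀ f ∈ J, ∀ a b : G, (fun g : G => f (a * g * b)) ∈ J)
    {H₁ H₂ H₃ : Subgroup G} (htpp : SubgroupTPP H₁ H₂ H₃)
    (hle : H₂ ≤ Subgroup.normalizer (H₃ : Set G) ∨ H₂ ≤ Subgroup.normalizer (H₁ : Set G))
    {f : G → ℂ} (hf : f ∈ J) (h1 : f 1 = 1)
    (h0 : ∀ a ∈ H₁, ∀ b ∈ H₂, ∀ c ∈ H₃, a * b * c ≠ 1 → f (a * b * c) = 0) :
    Nat.card H₁ * Nat.card H₂ * Nat.card H₃ ≤ Module.finrank ℂ J := by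
  rcases hle with hle | hle
  · have h := card_mul_card_inf_normalizer_mul_card_le_finrank J hJ htpp hf h1 h0
    rwa [inf_eq_left.2 hle] at h
  · have h := card_mul_card_normalizer_inf_mul_card_le_finrank J hJ htpp hf h1 h0
    rwa [inf_eq_right.2 hle] at h

omit [Finite G] in
/-- The span of the matrix coefficients of finitely many matrix representations has dimension
`≤ Σᵢ nᵢ²`. [folklore] -/
theorem finrank_repFun_le {ι : Type} [Fintype ι] (n : ι → ℕ)
    (ρ : ∀ i, G →* Matrix.GeneralLinearGroup (Fin (n i)) ℂ) :
    Module.finrank ℂ (Literature.Computability.AlgebraicComplexity.repFun n ρ) ≤ ∑ i, n i ^ 2 := by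
  classical
  let v : (Σ i : ι, Fin (n i) × Fin (n i)) → (G → ℂ) := fun t g =>
    ((ρ t.1 g : Matrix (Fin (n t.1)) (Fin (n t.1)) ℂ) t.2.1 t.2.2)
  have hset : {φ : G → ℂ | ∃ (i : ι) (a b : Fin (n i)),
      φ = fun g => ((ρ i g : Matrix (Fin (n i)) (Fin (n i)) ℂ) a b)} = Set.range v := by
    ext φ
    constructor
    · rintro ⟨i, a, b, rfl⟩
      exact ⟨⟨i, a, b⟩, rfl⟩
    · rintro ⟨⟨i, a, b⟩, rfl⟩
      exact ⟨i, a, b, rfl⟩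
  have h := finrank_range_le_card (R := ℂ) v
  rw [Fintype.card_sigma] at h
  simp only [Fintype.card_prod, Fintype.card_fin] at h
  unfold Literature.Computability.AlgebraicComplexity.repFun
  rw [hset]
  simpa [Set.finrank, sq] using h

/-- **Graded Plancherel inequality**: for a bi-invariant `J ≤ ℂ^G` and real `s ≥ 2`,
`dim J ≤ Σᶠ_{χ ∈ Irr(G) ∩ J} χ(1)^s` (Wedderburn blocks; `stub_support`: the Fourier support of `J` is
`P = {i : χᵢ ∈ J}`; `stub_expansion`: `J ≤ RepFun(P)`, `dim ≤ Σ_P dᵢ² ≤ Σ_P dᵢ^s`). -/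
theorem finrank_le_gradedBudget (J : Submodule ℂ (G → ℂ))
    (hJ : ∀ f ∈ J, ∀ a b : G, (fun g : G => f (a * g * b)) ∈ J) {s : ℝ} (hs : 2 ≤ s) :
    (Module.finrank ℂ J : ℝ) ≤ ∑ᶠ χ ∈ irrChars G ∩ (J : Set (G → ℂ)), (χ 1).re ^ s := by
  classical
  haveI : Fintype G := Fintype.ofFinite G
  obtain ⟨r, d, hd, ⟨φ⟩⟩ := exists_algEquiv_pi_matrix G
  haveI := hd
  let P : Fin r → Prop := fun i => (blockRep φ i).character ∈ J
  have hle : J ≤ Literature.Computability.AlgebraicComplexity.repFun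
      (fun i : {i : Fin r // P i} => d i.1)
      (fun i => ((((Pi.evalAlgHom ℂ (fun j : Fin r => Matrix (Fin (d j)) (Fin (d j)) ℂ) i.1).comp
        φ.toAlgHom).toMonoidHom).comp (MonoidAlgebra.of ℂ G)).toHomUnits) := by
    intro f hf
    refine Summit.MatrixMultiplication.MatrixMultiplication.Theorems.GradedPricing.stub_expansion
      φ P f fun i hi => ?_
    by_contra hne
    exact hi (Summit.MatrixMultiplication.MatrixMultiplication.Theorems.GradedPricing.stub_support
      φ J hJ hf hne)
  have h1 : Module.finrank ℂ J ≤ ∑ i : {i : Fin r // P i}, d i.1 ^ 2 :=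
    (Submodule.finrank_mono hle).trans (finrank_repFun_le _ _)
  have hfin : (irrChars G ∩ (J : Set (G → ℂ))).Finite :=
    (irrChars_finite_holds G).subset Set.inter_subset_left
  set χ : {i : Fin r // P i} → (G → ℂ) := fun i => (blockRep φ i.1).character with hχ
  have hinj : Function.Injective χ := fun i j h =>
    Subtype.ext (character_blockRep_injective φ h)
  have hmem : ∀ i, χ i ∈ irrChars G ∩ (J : Set (G → ℂ)) := fun i =>
    ⟨⟨Fin (d i.1) → ℂ, inferInstance, inferInstance, inferInstance, blockRep φ i.1,
      isIrreducible_blockRep φ i.1, rfl⟩, i.2⟩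
  have hdeg : ∀ i, ((χ i 1).re : ℝ) = d i.1 := fun i => by
    simp [hχ, Representation.char_one]
  have h2 : ∀ i : {i : Fin r // P i}, ((d i.1 : ℕ) : ℝ) ^ 2 ≤ (d i.1 : ℝ) ^ s := by
    intro i
    have hd1 : (1 : ℝ) ≤ d i.1 := by exact_mod_cast NeZero.one_le
    calc ((d i.1 : ℕ) : ℝ) ^ 2 = (d i.1 : ℝ) ^ (2 : ℝ) := by norm_cast
      _ ≤ (d i.1 : ℝ) ^ s := Real.rpow_le_rpow_of_exponent_le hd1 hs
  have h3 : ∑ i : {i : Fin r // P i}, (d i.1 : ℝ) ^ s =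
      ∑ ψ ∈ Finset.univ.image χ, (ψ 1).re ^ s := by
    rw [Finset.sum_image fun i _ j _ h => hinj h]
    exact Finset.sum_congr rfl fun i _ => by rw [hdeg]
  calc (Module.finrank ℂ J : ℝ) ≤ ((∑ i : {i : Fin r // P i}, d i.1 ^ 2 : ℕ) : ℝ) := by
        exact_mod_cast h1
    _ = ∑ i : {i : Fin r // P i}, ((d i.1 : ℕ) : ℝ) ^ 2 := by push_cast; rfl
    _ ≤ ∑ i : {i : Fin r // P i}, (d i.1 : ℝ) ^ s := Finset.sum_le_sum fun i _ => h2 i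
    _ = ∑ ψ ∈ Finset.univ.image χ, (ψ 1).re ^ s := h3
    _ ≤ ∑ ψ ∈ hfin.toFinset, (ψ 1).re ^ s := by
        refine Finset.sum_le_sum_of_subset_of_nonneg ?_ fun ψ hψ _ => ?_
        · intro ψ hψ
          rw [Finset.mem_image] at hψ
          obtain ⟨i, _, rfl⟩ := hψ
          exact hfin.mem_toFinset.2 (hmem i)
        · obtain ⟨n, -, hn⟩ := IsIrrChar.exists_apply_one (hfin.mem_toFinset.1 hψ).1
          rw [hn]
          exact Real.rpow_nonneg (by simp) _
    _ = ∑ᶠ χ ∈ irrChars G ∩ (J : Set (G → ℂ)), (χ 1).re ^ s :=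
        (finsum_mem_eq_finite_toFinset_sum _ hfin).symm

/-! ### Master form: isolable elements and one-sided stabilisers (landed as `Negative/StabilizerCount.lean`) -/

/-- **ISOLABLE-ELEMENT COUNT.**  `J ≤ ℂ^G` bi-invariant, `f ∈ J` an identity test on a set `S`
(`f 1 = 1`, `f = 0` on `S ∖ {1}`), `I ⊆ S` a finite set of ISOLABLE elements (each `x ∈ I` is
`u⁻¹v⁻¹` for some `u, v` with `u S v ⊆ S`).  Then `|I| ≤ dim J`: the probes `g ↦ f (u g v)` are
biorthogonal to the evaluations at the points of `I`. -/
theorem card_le_finrank_of_isolable (J : Submodule ℂ (G → ℂ))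
    (hJ : ∀ f ∈ J, ∀ a b : G, (fun g : G => f (a * g * b)) ∈ J)
    (S : Set G) {f : G → ℂ} (hf : f ∈ J) (h1 : f 1 = 1) (h0 : ∀ s ∈ S, s ≠ 1 → f s = 0)
    (I : Finset G) (hIS : ∀ x ∈ I, x ∈ S)
    (hI : ∀ x ∈ I, ∃ u v : G, u⁻¹ * v⁻¹ = x ∧ ∀ s ∈ S, u * s * v ∈ S) :
    I.card ≤ Module.finrank ℂ J := by
  classical
  haveI : Fintype G := Fintype.ofFinite G
  choose! u v huv hS using hI
  -- probes indexed by the subtype of `I`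
  let w : ↥I → J := fun x => ⟨fun g => f (u x * g * v x), hJ f hf _ _⟩
  have hw : ∀ x y : ↥I, (w x : G → ℂ) (y : G) = if x = y then 1 else 0 := by
    rintro ⟨x, hx⟩ ⟨y, hy⟩
    show f (u x * y * v x) = _
    by_cases hxy : x = y
    · subst hxy
      have e : u x * x * v x = 1 := by
        calc u x * x * v x = u x * ((u x)⁻¹ * (v x)⁻¹) * v x := by rw [huv x hx]
          _ = 1 := by group
      rw [e, h1, if_pos rfl]
    · rw [if_neg (fun h => hxy (congrArg Subtype.val h))]
      refine h0 _ (hS x hx y (hIS y hy)) fun h => hxy ?_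
      -- `u x * y * v x = 1` forces `y = (u x)⁻¹ (v x)⁻¹ = x`
      have hy' : y = (u x)⁻¹ * (v x)⁻¹ := by
        calc y = (u x)⁻¹ * (u x * y * v x) * (v x)⁻¹ := by group
          _ = (u x)⁻¹ * 1 * (v x)⁻¹ := by rw [h]
          _ = (u x)⁻¹ * (v x)⁻¹ := by group
      exact (hy'.trans (huv x hx)).symm
  have hli : LinearIndependent ℂ w := by
    rw [Fintype.linearIndependent_iff]
    intro g hg y
    have := congrArg (fun φ : J => (φ : G → ℂ) (y : G)) hg
    simpa [Submodule.coe_sum, Finset.sum_apply, hw, Finset.sum_ite_eq', Finset.mem_univ] using this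
  have h := hli.fintype_card_le_finrank
  rwa [Fintype.card_coe] at h

/-- **STABILIZER COUNT.**  If subgroups `L, R ≤ G` stabilise the tested set `S ∋ 1` from the left and
from the right (`L S ⊆ S`, `S R ⊆ S`) and `L ∩ R = 1`, then `|L| · |R| ≤ dim J`: every product `l r` is
isolable (`u = l⁻¹`, `v = r⁻¹`).  With `S = H₁H₂H₃`: `L = H₁`, `R = H₃` is the wall; `R = H₂H₃` (when a
subgroup) is the death of the Borel template; in general `R ⊇ H₃ · {b ∈ H₂ : b H₃ b⁻¹ ⊆ H₂H₃}`. -/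
theorem card_mul_card_le_finrank_of_stabilizers (J : Submodule ℂ (G → ℂ))
    (hJ : ∀ f ∈ J, ∀ a b : G, (fun g : G => f (a * g * b)) ∈ J)
    (S : Set G) (hS1 : (1 : G) ∈ S) {f : G → ℂ} (hf : f ∈ J) (h1 : f 1 = 1)
    (h0 : ∀ s ∈ S, s ≠ 1 → f s = 0)
    (L R : Subgroup G) (hL : ∀ l ∈ L, ∀ s ∈ S, l * s ∈ S) (hR : ∀ r ∈ R, ∀ s ∈ S, s * r ∈ S)
    (hLR : L ⊓ R = ⊥) :
    Nat.card L * Nat.card R ≤ Module.finrank ℂ J := by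
  classical
  haveI : Fintype G := Fintype.ofFinite G
  -- the product map is injective on `L × R`
  let m : ↥L × ↥R → G := fun t => (t.1 : G) * (t.2 : G)
  have hm : Function.Injective m := by
    rintro ⟨⟨l, hl⟩, ⟨r, hr⟩⟩ ⟨⟨l', hl'⟩, ⟨r', hr'⟩⟩ he
    simp only [m] at he
    have hmem : l'⁻¹ * l ∈ L ⊓ R := by
      refine Subgroup.mem_inf.2 ⟨L.mul_mem (L.inv_mem hl') hl, ?_⟩
      have : l'⁻¹ * l = r' * r⁻¹ := by
        calc l'⁻¹ * l = l'⁻¹ * (l * r) * r⁻¹ := by group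
          _ = l'⁻¹ * (l' * r') * r⁻¹ := by rw [he]
          _ = r' * r⁻¹ := by group
      rw [this]
      exact R.mul_mem hr' (R.inv_mem hr)
    rw [hLR, Subgroup.mem_bot, inv_mul_eq_one] at hmem
    subst hmem
    have hrr : r = r' := mul_left_cancel he
    subst hrr
    rfl
  -- its image consists of isolable elements of `S`
  set I : Finset G := Finset.univ.image m with hIdef
  have hcard : I.card = Nat.card L * Nat.card R := by
    rw [hIdef, Finset.card_image_of_injective _ hm, Finset.card_univ, Fintype.card_prod,
      Nat.card_eq_fintype_card, Nat.card_eq_fintype_card]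
  rw [← hcard]
  refine card_le_finrank_of_isolable J hJ S hf h1 h0 I (fun x hx => ?_) (fun x hx => ?_)
  · obtain ⟨⟨⟨l, hl⟩, ⟨r, hr⟩⟩, -, rfl⟩ := Finset.mem_image.1 hx
    exact hR r hr _ (by simpa using hL l hl 1 hS1)
  · obtain ⟨⟨⟨l, hl⟩, ⟨r, hr⟩⟩, -, rfl⟩ := Finset.mem_image.1 hx
    refine ⟨l⁻¹, r⁻¹, by simp [m], fun s hs => ?_⟩
    exact hR _ (R.inv_mem hr) _ (hL _ (L.inv_mem hl) s hs)

/-! ### Triangular (certified-rank) form (landed as `Negative/TriangularCount.lean`) -/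

/-- **TRIANGULAR COUNT.**  If `s : Fin n → G` is injective and certified by `(u, v)` — `uᵢ sᵢ vᵢ = 1`
and `uᵢ sⱼ vᵢ ∈ S` for `j < i` — then `n ≤ dim J` for every bi-invariant `J` carrying an identity test
on `S` (the points `sᵢ` themselves need not lie in `S`). -/
theorem card_le_finrank_of_triangular (J : Submodule ℂ (G → ℂ))
    (hJ : ∀ f ∈ J, ∀ a b : G, (fun g : G => f (a * g * b)) ∈ J)
    (S : Set G) {f : G → ℂ} (hf : f ∈ J) (h1 : f 1 = 1) (h0 : ∀ s ∈ S, s ≠ 1 → f s = 0)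
    {n : ℕ} (s u v : Fin n → G) (hinj : Function.Injective s)
    (hdiag : ∀ i, u i * s i * v i = 1) (hlow : ∀ i j, j < i → u i * s j * v i ∈ S) :
    n ≤ Module.finrank ℂ J := by
  classical
  haveI : Fintype G := Fintype.ofFinite G
  let w : Fin n → J := fun i => ⟨fun g => f (u i * g * v i), hJ f hf _ _⟩
  -- the value matrix is unitriangular: `1` on the diagonal, `0` below
  have hM1 : ∀ i, (w i : G → ℂ) (s i) = 1 := fun i => by
    show f (u i * s i * v i) = 1
    rw [hdiag, h1]
  have hM0 : ∀ i j, j < i → (w i : G → ℂ) (s j) = 0 := by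
    intro i j hji
    show f (u i * s j * v i) = 0
    refine h0 _ (hlow i j hji) fun h => (ne_of_gt hji) (hinj ?_)
    -- `uᵢ sⱼ vᵢ = 1 = uᵢ sᵢ vᵢ` forces `sⱼ = sᵢ`
    have e : u i * s j * v i = u i * s i * v i := by rw [h, hdiag]
    have e' : s j = s i := by
      calc s j = (u i)⁻¹ * (u i * s j * v i) * (v i)⁻¹ := by group
        _ = (u i)⁻¹ * (u i * s i * v i) * (v i)⁻¹ := by rw [e]
        _ = s i := by group
    exact e'.symm
  -- linear independence by forward substitution
  have hli : LinearIndependent ℂ w := by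
    rw [Fintype.linearIndependent_iff]
    intro c hc
    have hev : ∀ j, ∑ i, c i * (w i : G → ℂ) (s j) = 0 := fun j => by
      have := congrArg (fun φ : J => (φ : G → ℂ) (s j)) hc
      simpa [Submodule.coe_sum, Finset.sum_apply] using this
    -- strong induction on the index
    suffices h : ∀ m : ℕ, ∀ j : Fin n, (j : ℕ) = m → c j = 0 from fun j => h j j rfl
    intro m
    induction m using Nat.strong_induction_on with
    | _ m ih =>
      intro j hj
      have key : ∑ i, c i * (w i : G → ℂ) (s j) = c j := by
        rw [Finset.sum_eq_single j]
        · rw [hM1, mul_one]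
        · intro i _ hij
          rcases lt_or_gt_of_ne hij with h | h
          · -- `i < j`: coefficient already known to vanish
            rw [ih i (by rw [← hj]; exact h) i rfl, zero_mul]
          · -- `j < i`: certified zero of the value matrix
            rw [hM0 i j h, mul_zero]
        · intro h; exact absurd (Finset.mem_univ j) h
      rw [← key]
      exact hev j
  simpa using hli.fintype_card_le_finrank

end AbstractCount

/-! ## The count for the crux: `ν`-charges against `N_k`, and the death of every
"middle normalises outer" configuration (the Borel template included) -/

section CruxCount

variable [Fact p.Prime] {k : ℕ} {H₁ H₂ H₃ : Subgroup (GLm p m)}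

/-- **`|H₁| · |H₂ ∩ N(H₃)| · |H₃| ≤ dim F_k|_G ≤ N_k`** for every subgroup identity design of the crux. -/
theorem inf_normalizer_count (htpp : SubgroupTPP H₁ H₂ H₃) (htest : IdTest k H₁ H₂ H₃) :
    Nat.card H₁ * Nat.card ↥(H₂ ⊓ Subgroup.normalizer (H₃ : Set (GLm p m))) * Nat.card H₃ ≤
      Fintype.card (RankLE p m k) := by
  obtain ⟨f, hf, h1, h0⟩ := idTest_iff.1 htest
  exact (card_mul_card_inf_normalizer_mul_card_le_finrank (levelSubmodule p m k) levelSubmodule_biInv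
    htpp hf h1 h0).trans finrank_levelSubmodule_le

/-- **`|H₁| · |N(H₁) ∩ H₂| · |H₃| ≤ dim F_k|_G ≤ N_k`** for every subgroup identity design of the crux. -/
theorem normalizer_inf_count (htpp : SubgroupTPP H₁ H₂ H₃) (htest : IdTest k H₁ H₂ H₃) :
    Nat.card H₁ * Nat.card ↥(Subgroup.normalizer (H₁ : Set (GLm p m)) ⊓ H₂) * Nat.card H₃ ≤
      Fintype.card (RankLE p m k) := by
  obtain ⟨f, hf, h1, h0⟩ := idTest_iff.1 htest
  exact (card_mul_card_normalizer_inf_mul_card_le_finrank (levelSubmodule p m k) levelSubmodule_biInv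
    htpp hf h1 h0).trans finrank_levelSubmodule_le

/-- **Middle normalises outer ⇒ `V ≤ dim F_k|_G`.** -/
theorem volume_le_finrank_level (htpp : SubgroupTPP H₁ H₂ H₃)
    (hle : H₂ ≤ Subgroup.normalizer (H₃ : Set (GLm p m)) ∨ H₂ ≤ Subgroup.normalizer (H₁ : Set (GLm p m)))
    (htest : IdTest k H₁ H₂ H₃) :
    Nat.card H₁ * Nat.card H₂ * Nat.card H₃ ≤ Module.finrank ℂ (levelSubmodule p m k) := by
  obtain ⟨f, hf, h1, h0⟩ := idTest_iff.1 htest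
  exact volume_le_finrank_of_le_normalizer (levelSubmodule p m k) levelSubmodule_biInv htpp hle hf h1 h0

/-- **Middle normalises outer ⇒ `V ≤ N_k = #{M ∈ M_m(𝔽_p) : rk M ≤ k}`** (`≈ p^{2mk−k²}`).  For the
Borel template of card `borel-configuration-identity-test` (`H₂ ≤ N(H₃)`, see the module docstring)
this contradicts its volume `Θ(N_k^{3/2}/p)`: the template fails the identity test at every `k,m,p`. -/
theorem volume_le_card_rankLE_of_le_normalizer (htpp : SubgroupTPP H₁ H₂ H₃)
    (hle : H₂ ≤ Subgroup.normalizer (H₃ : Set (GLm p m)) ∨ H₂ ≤ Subgroup.normalizer (H₁ : Set (GLm p m)))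
    (htest : IdTest k H₁ H₂ H₃) :
    Nat.card H₁ * Nat.card H₂ * Nat.card H₃ ≤ Fintype.card (RankLE p m k) :=
  (volume_le_finrank_level htpp hle htest).trans finrank_levelSubmodule_le

/-- **Middle PERMUTES with an outer group (`H₃H₂ ⊆ H₂H₃`, e.g. `H₂H₃` a subgroup; or
`H₂H₁ ⊆ H₁H₂`) ⇒ `V ≤ N_k`.**  The sharper form of the template death: two pieces inside a common
Borel that permute can never be the middle and an outer group of a design. -/
theorem volume_le_card_rankLE_of_perm (htpp : SubgroupTPP H₁ H₂ H₃)
    (hperm : (∀ z ∈ H₃, ∀ y ∈ H₂, ∃ y' ∈ H₂, ∃ z' ∈ H₃, z * y = y' * z') ∨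
      (∀ y ∈ H₂, ∀ x ∈ H₁, ∃ x' ∈ H₁, ∃ y' ∈ H₂, y * x = x' * y'))
    (htest : IdTest k H₁ H₂ H₃) :
    Nat.card H₁ * Nat.card H₂ * Nat.card H₃ ≤ Fintype.card (RankLE p m k) := by
  obtain ⟨f, hf, h1, h0⟩ := idTest_iff.1 htest
  exact (volume_le_finrank_of_perm (levelSubmodule p m k) levelSubmodule_biInv htpp hperm hf h1 h0).trans
    finrank_levelSubmodule_le

/-- **Middle permutes with outer ⇒ `V ≤ budget_s` for every `s ≥ 2`.** -/
theorem vol_le_budget_of_perm (htpp : SubgroupTPP H₁ H₂ H₃)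
    (hperm : (∀ z ∈ H₃, ∀ y ∈ H₂, ∃ y' ∈ H₂, ∃ z' ∈ H₃, z * y = y' * z') ∨
      (∀ y ∈ H₂, ∀ x ∈ H₁, ∃ x' ∈ H₁, ∃ y' ∈ H₂, y * x = x' * y'))
    (htest : IdTest k H₁ H₂ H₃) {s : ℝ} (hs : 2 ≤ s) : vol H₁ H₂ H₃ ≤ budget p m k s := by
  obtain ⟨f, hf, h1, h0⟩ := idTest_iff.1 htest
  rw [budget_eq]
  exact (Nat.cast_le.2 (volume_le_finrank_of_perm (levelSubmodule p m k) levelSubmodule_biInv htpp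
    hperm hf h1 h0)).trans (finrank_le_gradedBudget _ levelSubmodule_biInv hs)

/-- **No "middle permutes with outer" design at any `0 < ε ≤ 1`.** -/
theorem no_design_of_perm {ε : ℝ} (hε : 0 < ε) (hε1 : ε ≤ 1) (htpp : SubgroupTPP H₁ H₂ H₃)
    (hperm : (∀ z ∈ H₃, ∀ y ∈ H₂, ∃ y' ∈ H₂, ∃ z' ∈ H₃, z * y = y' * z') ∨
      (∀ y ∈ H₂, ∀ x ∈ H₁, ∃ x' ∈ H₁, ∃ y' ∈ H₂, y * x = x' * y'))
    (htest : IdTest k H₁ H₂ H₃) : ¬ budget p m k (2 + ε) < vol H₁ H₂ H₃ ^ ((2 + ε) / 3) := by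
  intro hlt
  have h1 := vol_le_budget_of_perm htpp hperm htest (s := 2 + ε) (by linarith)
  have h2 := vol_rpow_le_vol hε1 H₁ H₂ H₃
  linarith

/-- **Middle normalises outer ⇒ `V ≤ budget_s` for every `s ≥ 2`.** -/
theorem vol_le_budget_of_le_normalizer (htpp : SubgroupTPP H₁ H₂ H₃)
    (hle : H₂ ≤ Subgroup.normalizer (H₃ : Set (GLm p m)) ∨ H₂ ≤ Subgroup.normalizer (H₁ : Set (GLm p m)))
    (htest : IdTest k H₁ H₂ H₃) {s : ℝ} (hs : 2 ≤ s) : vol H₁ H₂ H₃ ≤ budget p m k s := by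
  rw [budget_eq]
  exact (Nat.cast_le.2 (volume_le_finrank_level htpp hle htest)).trans
    (finrank_le_gradedBudget _ levelSubmodule_biInv hs)

/-- **No "middle normalises outer" design at any `0 < ε ≤ 1`:** `V^{(2+ε)/3} ≤ V ≤ budget`. -/
theorem no_design_of_le_normalizer {ε : ℝ} (hε : 0 < ε) (hε1 : ε ≤ 1) (htpp : SubgroupTPP H₁ H₂ H₃)
    (hle : H₂ ≤ Subgroup.normalizer (H₃ : Set (GLm p m)) ∨ H₂ ≤ Subgroup.normalizer (H₁ : Set (GLm p m)))
    (htest : IdTest k H₁ H₂ H₃) : ¬ budget p m k (2 + ε) < vol H₁ H₂ H₃ ^ ((2 + ε) / 3) := by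
  intro hlt
  have h1 := vol_le_budget_of_le_normalizer htpp hle htest (s := 2 + ε) (by linarith)
  have h2 := vol_rpow_le_vol hε1 H₁ H₂ H₃
  linarith

/-- The tested product set `H₁H₂H₃` of the crux. -/
def prodSet (H₁ H₂ H₃ : Subgroup (GLm p m)) : Set (GLm p m) :=
  {g | ∃ a ∈ H₁, ∃ b ∈ H₂, ∃ c ∈ H₃, g = a * b * c}

omit [Fact p.Prime] in
theorem one_mem_prodSet : (1 : GLm p m) ∈ prodSet H₁ H₂ H₃ :=
  ⟨1, H₁.one_mem, 1, H₂.one_mem, 1, H₃.one_mem, by simp⟩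

/-- **STABILIZER COUNT for the crux.**  If subgroups `L, R ≤ GL_m(𝔽_p)` with `L ∩ R = 1` stabilise the
product set `S = H₁H₂H₃` from the left and from the right (`L S ⊆ S`, `S R ⊆ S`), then a level-`k`
identity test forces `|L| · |R| ≤ dim F_k|_G ≤ N_k`.  (`L = H₁`, `R = H₃`: the wall; `R = H₂H₃` a
subgroup: template death; in general `R ⊇ H₃·{b ∈ H₂ : bH₃b⁻¹ ⊆ H₂H₃}`, `L ⊇ {b : b⁻¹H₁b ⊆ H₁H₂}·H₁`.)
No TPP needed. -/
theorem stabilizer_count (L R : Subgroup (GLm p m))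
    (hL : ∀ l ∈ L, ∀ s ∈ prodSet H₁ H₂ H₃, l * s ∈ prodSet H₁ H₂ H₃)
    (hR : ∀ r ∈ R, ∀ s ∈ prodSet H₁ H₂ H₃, s * r ∈ prodSet H₁ H₂ H₃)
    (hLR : L ⊓ R = ⊥) (htest : IdTest k H₁ H₂ H₃) :
    Nat.card L * Nat.card R ≤ Fintype.card (RankLE p m k) := by
  obtain ⟨f, hf, h1, h0⟩ := idTest_iff.1 htest
  refine (card_mul_card_le_finrank_of_stabilizers (levelSubmodule p m k) levelSubmodule_biInv
    (prodSet H₁ H₂ H₃) one_mem_prodSet hf h1 (fun s hs hne => ?_) L R hL hR hLR).trans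
    finrank_levelSubmodule_le
  obtain ⟨a, ha, b, hb, c, hc, rfl⟩ := hs
  exact h0 a ha b hb c hc hne

end CruxCount

/-- **SUB-FAMILY REFUTED (middle group inside the normaliser of an outer group).**  The crux
restricted to triples with `H₂ ≤ N_G(H₃)` or `H₂ ≤ N_G(H₁)` — which contains the Borel template of
the only idea card on the item, every `(U⁻, T, U⁺)`-type triple, and every triple whose middle group is
a torus normalising an outer pattern group — is FALSE (already at `ε = 1`). -/
theorem not_subgroupIdentityDesigns_of_le_normalizer :
    ¬ (∀ ε : ℝ, 0 < ε → ∃ (p : ℕ) (_ : Fact p.Prime) (m k : ℕ) (H₁ H₂ H₃ : Subgroup (GLm p m)),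
        (H₂ ≤ Subgroup.normalizer (H₃ : Set (GLm p m)) ∨ H₂ ≤ Subgroup.normalizer (H₁ : Set (GLm p m))) ∧
        SubgroupTPP H₁ H₂ H₃ ∧ IdTest k H₁ H₂ H₃ ∧
        budget p m k (2 + ε) < vol H₁ H₂ H₃ ^ ((2 + ε) / 3)) := by
  intro h
  obtain ⟨p, hp, m, k, H₁, H₂, H₃, hle, htpp, htest, hlt⟩ := h 1 one_pos
  exact no_design_of_le_normalizer one_pos le_rfl htpp hle htest hlt

/-! ## TIGHTNESS: the normaliser hypothesis is needed (`S₃`, top level) -/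

section Tightness

/-- **The hypothesis `H₂ ≤ N(H₃) ∨ H₂ ≤ N(H₁)` cannot be dropped, and `V ≤ |G|` is false for subgroup
identity designs in general.**  In `S₃` (`≅ GL_2(𝔽_2)`, top level `J = ℂ^G`, `dim J = |G| = 6`) the
three transposition subgroups form a subgroup TPP triple, `δ_1` is an identity test, and
`V = 8 > 6`.  (Graded Neumann `|H₁||H₃| + |H₁|(|H₂|−1) = 4 + 2 ≤ 6` is tight; here
`N(H₁) ∩ H₂ = H₂ ∩ N(H₃) = 1`.) -/
theorem exists_idTest_volume_gt_finrank :
    ∃ (H₁ H₂ H₃ : Subgroup (Equiv.Perm (Fin 3))) (f : Equiv.Perm (Fin 3) → ℂ),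
      SubgroupTPP H₁ H₂ H₃ ∧ f ∈ (⊤ : Submodule ℂ (Equiv.Perm (Fin 3) → ℂ)) ∧ f 1 = 1 ∧
      (∀ a ∈ H₁, ∀ b ∈ H₂, ∀ c ∈ H₃, a * b * c ≠ 1 → f (a * b * c) = 0) ∧
      Module.finrank ℂ (⊤ : Submodule ℂ (Equiv.Perm (Fin 3) → ℂ)) <
        Nat.card H₁ * Nat.card H₂ * Nat.card H₃ := by
  classical
  -- the three transpositions
  set s₁ : Equiv.Perm (Fin 3) := Equiv.swap 0 1 with hs₁
  set s₂ : Equiv.Perm (Fin 3) := Equiv.swap 0 2 with hs₂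
  set s₃ : Equiv.Perm (Fin 3) := Equiv.swap 1 2 with hs₃
  have ord : ∀ s : Equiv.Perm (Fin 3), s ^ 2 = 1 → s ≠ 1 → orderOf s = 2 := fun s h2 h1 =>
    orderOf_eq_prime h2 h1
  have mem2 : ∀ {s x : Equiv.Perm (Fin 3)}, s ^ 2 = 1 → s ≠ 1 →
      (x ∈ Subgroup.zpowers s ↔ x = 1 ∨ x = s) := by
    intro s x h2 h1
    rw [(isOfFinOrder_of_finite s).mem_zpowers_iff_mem_range_orderOf, ord s h2 h1]
    simp [Finset.mem_image, Finset.mem_range]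
    constructor
    · rintro ⟨i, hi, rfl⟩
      interval_cases i <;> simp
    · rintro (rfl | rfl)
      · exact ⟨0, by norm_num, by simp⟩
      · exact ⟨1, by norm_num, by simp⟩
  have h1sq : s₁ ^ 2 = 1 := by rw [hs₁]; decide
  have h2sq : s₂ ^ 2 = 1 := by rw [hs₂]; decide
  have h3sq : s₃ ^ 2 = 1 := by rw [hs₃]; decide
  have h1ne : s₁ ≠ 1 := by rw [hs₁]; decide
  have h2ne : s₂ ≠ 1 := by rw [hs₂]; decide
  have h3ne : s₃ ≠ 1 := by rw [hs₃]; decide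
  refine ⟨Subgroup.zpowers s₁, Subgroup.zpowers s₂, Subgroup.zpowers s₃,
    fun g => if g = 1 then 1 else 0, ?_, Submodule.mem_top, if_pos rfl, ?_, ?_⟩
  · -- TPP: eight cases
    intro a ha b hb c hc habc
    rw [mem2 h1sq h1ne] at ha
    rw [mem2 h2sq h2ne] at hb
    rw [mem2 h3sq h3ne] at hc
    rcases ha with rfl | rfl <;> rcases hb with rfl | rfl <;> rcases hc with rfl | rfl <;>
      first
      | exact ⟨rfl, rfl, rfl⟩
      | (exfalso; revert habc; rw [hs₁, hs₂, hs₃]; decide)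
      | (exfalso; revert habc; rw [hs₁]; decide)
      | (exfalso; revert habc; rw [hs₂]; decide)
      | (exfalso; revert habc; rw [hs₃]; decide)
  · intro a _ b _ c _ hne
    show (if a * b * c = 1 then (1 : ℂ) else 0) = 0
    rw [if_neg hne]
  · rw [finrank_top, Module.finrank_fintype_fun_eq_card, Fintype.card_perm, Fintype.card_fin,
      Nat.card_zpowers, Nat.card_zpowers, Nat.card_zpowers, ord s₁ h1sq h1ne, ord s₂ h2sq h2ne,
      ord s₃ h3sq h3ne]
    decide

end Tightness

/-! ## LOAD-BEARING ANALYSIS: dropping the identity test or dropping the TPP makes the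
statement trivially TRUE (so both carry the difficulty, jointly with the graded budget) -/

section Abelian

/-- `GL_1(𝔽_p)` is commutative. [folklore] -/
theorem glOne_comm (a b : GLm p 1) : a * b = b * a := by
  apply Units.ext
  ext i j
  fin_cases i; fin_cases j
  simp [Matrix.mul_apply, mul_comm]

/-- `M_1(𝔽_p) ≃ 𝔽_p` (the unique entry). [folklore] -/
def matOneEquiv (p : ℕ) : Mat p 1 ≃ ZMod p where
  toFun M := M 0 0
  invFun a := Matrix.of fun _ _ => a
  left_inv M := by
    ext i j; fin_cases i; fin_cases j; rfl
  right_inv a := rfl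

variable [Fact p.Prime]

/-- Orthogonality of additive characters on `1 × 1` matrices:
`Σ_{M ∈ M_1(𝔽_p)} ψ(tr(M D)) = p·[D = 0]`. [folklore] -/
theorem sum_psi_matOne (D : Mat p 1) :
    ∑ M : Mat p 1, ZMod.stdAddChar (Matrix.trace (M * D)) = if D = 0 then (p : ℂ) else 0 := by
  classical
  have h := AddChar.sum_mulShift (R := ZMod p) (D 0 0) (ZMod.isPrimitive_stdAddChar p)
  rw [← Equiv.sum_comp (matOneEquiv p).symm]
  have hterm : ∀ a : ZMod p, ZMod.stdAddChar (Matrix.trace ((matOneEquiv p).symm a * D)) =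
      ZMod.stdAddChar (a * D 0 0) := by
    intro a
    congr 1
    rw [Matrix.trace_fin_one, Matrix.mul_apply]
    simp [matOneEquiv]
  simp_rw [hterm]
  rw [h]
  have hD : D 0 0 = 0 ↔ D = 0 := by
    constructor
    · intro h0; ext i j; fin_cases i; fin_cases j; exact h0
    · intro h0; rw [h0]; rfl
  by_cases hD0 : D = 0
  · rw [if_pos (hD.mpr hD0), if_pos hD0, ZMod.card]
  · rw [if_neg (fun h0 => hD0 (hD.mp h0)), if_neg hD0, Nat.cast_zero]

/-- **Fourier inversion on `GL_1(𝔽_p)`**: for `k ≥ 1` every function is of level `k`. [folklore] -/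
theorem levelSet_matOne_eq_univ {k : ℕ} (hk : 1 ≤ k) : levelSet p 1 k = Set.univ := by
  classical
  refine Set.eq_univ_of_forall fun f => ?_
  have hp0 : (p : ℂ) ≠ 0 := Nat.cast_ne_zero.mpr (NeZero.ne p)
  refine ⟨fun M => (p : ℂ)⁻¹ * ∑ h : GLm p 1, f h * ZMod.stdAddChar (Matrix.trace (M * (-(h : Mat p 1)))),
    ?_, fun g => ?_⟩
  · intro M hM
    exfalso
    have := Matrix.rank_le_width M
    omega
  · unfold fourierFn
    have hexp : ∀ M : Mat p 1,
        ((p : ℂ)⁻¹ * ∑ h : GLm p 1, f h * ZMod.stdAddChar (Matrix.trace (M * (-(h : Mat p 1))))) *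
          ZMod.stdAddChar (Matrix.trace (M * (g : Mat p 1))) =
        (p : ℂ)⁻¹ * ∑ h : GLm p 1, f h * ZMod.stdAddChar (Matrix.trace (M * ((g : Mat p 1) - (h : Mat p 1)))) := by
      intro M
      rw [mul_assoc, Finset.sum_mul]
      congr 1
      refine Finset.sum_congr rfl fun h _ => ?_
      rw [mul_assoc, ← AddChar.map_add_eq_mul, ← Matrix.trace_add, ← Matrix.mul_add,
        neg_add_eq_sub]
    simp_rw [hexp]
    rw [← Finset.mul_sum, Finset.sum_comm]
    simp_rw [← Finset.mul_sum, sum_psi_matOne, sub_eq_zero]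
    have hval : ∀ h : GLm p 1, f h * (if ((g : Mat p 1) = (h : Mat p 1)) then (p : ℂ) else 0) =
        if g = h then f g * p else 0 := by
      intro h
      by_cases hgh : g = h
      · subst hgh; simp
      · rw [if_neg (fun e => hgh (Units.ext e)), if_neg hgh, mul_zero]
    simp_rw [hval]
    rw [Finset.sum_ite_eq, if_pos (Finset.mem_univ _), ← mul_assoc, mul_comm ((p : ℂ)⁻¹),
      mul_assoc, inv_mul_cancel₀ hp0, mul_one]

/-- For the commutative group `GL_1(𝔽_p)` all irreducible characters have degree `1`, so the full
budget equals `|G|` at every exponent: `budget p 1 k s = |GL_1(𝔽_p)|` for `k ≥ 1`. [folklore] -/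
theorem budget_matOne {k : ℕ} (hk : 1 ≤ k) (s : ℝ) :
    budget p 1 k s = Fintype.card (GLm p 1) := by
  classical
  haveI : IsMulCommutative (GLm p 1) := ⟨⟨glOne_comm⟩⟩
  have hone : ∀ χ ∈ irrChars (GLm p 1), χ 1 = 1 := by
    rintro χ ⟨V, _, _, _, ρ, hρ, rfl⟩
    haveI := hρ
    rw [Representation.char_one, Representation.IsIrreducible.finrank_eq_one_of_isMulCommutative ρ,
      Nat.cast_one]
  have hfin : (irrChars (GLm p 1)).Finite := irrChars_finite_holds _
  have hcount : (hfin.toFinset.card : ℂ) = Fintype.card (GLm p 1) := by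
    have h := sum_sq_charDegrees_holds (GLm p 1)
    rw [finsum_mem_eq_finite_toFinset_sum _ hfin, Nat.card_eq_fintype_card] at h
    rw [← h, Finset.sum_congr rfl fun χ hχ => by rw [hone χ (hfin.mem_toFinset.mp hχ), one_pow],
      Finset.sum_const, nsmul_eq_mul, mul_one]
  have hcount' : hfin.toFinset.card = Fintype.card (GLm p 1) := by exact_mod_cast hcount
  unfold budget
  rw [levelSet_matOne_eq_univ hk, Set.inter_univ, finsum_mem_eq_finite_toFinset_sum _ hfin,
    Finset.sum_congr rfl fun χ hχ => by rw [hone χ (hfin.mem_toFinset.mp hχ), Complex.one_re,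
      Real.one_rpow], Finset.sum_const, nsmul_eq_mul, mul_one, hcount']

/-- A constant irreducible character is the trivial character. -/
theorem eq_trivial_of_const {G : Type} [Group G] [Fintype G] {χ : G → ℂ} (hχ : χ ∈ irrChars G)
    {K : ℂ} (hK : ∀ g, χ g = K) : χ = (Representation.trivial ℂ G ℂ).character := by
  classical
  have h1 : classInner χ χ = 1 := by rw [IsIrrChar.classInner_eq hχ hχ, if_pos rfl]
  rw [classInner_apply] at h1
  simp_rw [hK] at h1
  rw [Finset.sum_const, Finset.card_univ, nsmul_eq_mul, ← mul_assoc, inv_mul_cancel₀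
    (Nat.cast_ne_zero.mpr Fintype.card_ne_zero), one_mul] at h1
  obtain ⟨d, -, hd⟩ := IsIrrChar.exists_apply_one hχ
  have hKd : K = d := (hK 1).symm.trans hd
  rw [hKd] at h1
  have hd1 : d = 1 := by
    have : (d : ℂ) * d = (d * d : ℕ) := by push_cast; ring
    rw [this, show (1 : ℂ) = ((1 : ℕ) : ℂ) from Nat.cast_one.symm] at h1
    have h2 : d * d = 1 := Nat.cast_injective h1
    exact Nat.eq_one_of_mul_eq_one_left h2
  funext g
  rw [hK, character_trivial_apply, hKd, hd1, Nat.cast_one]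

/-- **At level `0` the graded budget is exactly `1`** (only the trivial character is constant). -/
theorem budget_levelZero (s : ℝ) : budget p m 0 s = 1 := by
  have hset : irrChars (GLm p m) ∩ levelSet p m 0 =
      {(Representation.trivial ℂ (GLm p m) ℂ).character} := by
    ext χ
    constructor
    · rintro ⟨hχ, c, hc, hfc⟩
      exact eq_trivial_of_const hχ (K := c 0) fun g => by
        rw [hfc, fourierFn_const_of_rankSupp_zero hc]
    · rintro rfl
      exact trivial_mem_levelSet 0
  unfold budget
  rw [hset, finsum_mem_singleton, character_trivial_apply]
  simp

/-- `GL_1(𝔽_3)` is not trivial (`-1 ≠ 1`), so `|GL_1(𝔽_3)| ≥ 2`. -/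
theorem two_le_card_glOne_three : 2 ≤ Nat.card (GLm 3 1) := by
  classical
  haveI : Nontrivial (GLm 3 1) := ⟨⟨-1, 1, by decide⟩⟩
  rw [Nat.card_eq_fintype_card]
  exact Fintype.one_lt_card

end Abelian

/-- **WITHOUT THE IDENTITY TEST the statement is trivially TRUE.**  Drop the test clause: at level
`k = 0` the budget is `1`, and the TPP triple `(⊤, 1, 1)` in `GL_1(𝔽_3)` has `V = 2`, `V^{(2+ε)/3} > 1`.
So the identity test is load-bearing. -/
theorem withoutIdTest_holds :
    ∀ ε : ℝ, 0 < ε → ∃ (p : ℕ) (_ : Fact p.Prime) (m k : ℕ) (H₁ H₂ H₃ : Subgroup (GLm p m)),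
      SubgroupTPP H₁ H₂ H₃ ∧ budget p m k (2 + ε) < vol H₁ H₂ H₃ ^ ((2 + ε) / 3) := by
  intro ε hε
  haveI : Fact (Nat.Prime 3) := ⟨Nat.prime_three⟩
  refine ⟨3, inferInstance, 1, 0, ⊤, ⊥, ⊥, ?_, ?_⟩
  · intro a _ b hb c hc _
    rw [Subgroup.mem_bot] at hb hc
    subst hb hc
    simpa using ‹a * 1 * 1 = 1›
  · rw [budget_levelZero]
    have hV : (1 : ℝ) < vol (⊤ : Subgroup (GLm 3 1)) ⊥ ⊥ := by
      unfold vol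
      rw [Subgroup.card_top, Subgroup.card_bot, mul_one, mul_one]
      exact_mod_cast two_le_card_glOne_three
    exact Real.one_lt_rpow hV (by linarith)

/-- **WITHOUT THE SUBGROUP TPP the statement is trivially TRUE.**  Drop `SubgroupTPP`: in `GL_1(𝔽_3)`
at level `k = 1` take `H₁ = H₂ = H₃ = ⊤` and the test `f = δ_1` (every function has level `1`,
`levelSet_matOne_eq_univ`); the budget is `|G| = N` while `V^{(2+ε)/3} = N^{2+ε} > N` (`N = 2`).
So the TPP is load-bearing. -/
theorem withoutTPP_holds :
    ∀ ε : ℝ, 0 < ε → ∃ (p : ℕ) (_ : Fact p.Prime) (m k : ℕ) (H₁ H₂ H₃ : Subgroup (GLm p m)),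
      IdTest k H₁ H₂ H₃ ∧ budget p m k (2 + ε) < vol H₁ H₂ H₃ ^ ((2 + ε) / 3) := by
  intro ε hε
  classical
  haveI : Fact (Nat.Prime 3) := ⟨Nat.prime_three⟩
  refine ⟨3, inferInstance, 1, 1, ⊤, ⊤, ⊤, ?_, ?_⟩
  · -- `δ_1` is a level-1 function on `GL_1(𝔽_3)`
    have hδ : (fun g : GLm 3 1 => if g = 1 then (1 : ℂ) else 0) ∈ levelSet 3 1 1 := by
      rw [levelSet_matOne_eq_univ le_rfl]; trivial
    obtain ⟨c, hc, hfc⟩ := hδ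
    have hfc' : ∀ g : GLm 3 1, fourierFn c g = if g = 1 then 1 else 0 := fun g => (hfc g).symm
    refine ⟨c, hc, ?_, fun a _ b _ g _ hne => ?_⟩
    · rw [hfc' 1, if_pos rfl]
    · rw [hfc' (a * b * g), if_neg hne]
  · rw [budget_matOne le_rfl]
    set N : ℕ := Nat.card (GLm 3 1) with hN
    have hN2 : (2 : ℝ) ≤ N := by exact_mod_cast two_le_card_glOne_three
    have hvol : vol (⊤ : Subgroup (GLm 3 1)) ⊤ ⊤ = (N : ℝ) ^ (3 : ℕ) := by
      unfold vol; rw [Subgroup.card_top]; push_cast; ring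
    rw [hvol, ← Nat.card_eq_fintype_card, ← hN, ← Real.rpow_natCast,
      ← Real.rpow_mul (by linarith), show ((3 : ℕ) : ℝ) * ((2 + ε) / 3) = 2 + ε by push_cast; ring]
    calc (N : ℝ) = (N : ℝ) ^ (1 : ℝ) := (Real.rpow_one _).symm
      _ < (N : ℝ) ^ (2 + ε) := Real.rpow_lt_rpow_of_exponent_lt (by linarith) (by linarith)

/-! ## The abelian slice `m = 1` is dead for `ε ≤ 1` -/

section MatOne

variable [Fact p.Prime] {k : ℕ} {H₁ H₂ H₃ : Subgroup (GLm p 1)}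

/-- In the commutative group `GL_1(𝔽_p)` a subgroup TPP triple multiplies injectively into `G`,
so `V ≤ |G|`. [folklore] -/
theorem vol_le_card_matOne (htpp : SubgroupTPP H₁ H₂ H₃) :
    Nat.card H₁ * Nat.card H₂ * Nat.card H₃ ≤ Nat.card (GLm p 1) := by
  classical
  let F : ↥H₁ × ↥H₂ × ↥H₃ → GLm p 1 := fun t => (t.1 : GLm p 1) * t.2.1 * t.2.2
  have hF : Function.Injective F := by
    rintro ⟨⟨a, ha⟩, ⟨b, hb⟩, ⟨c, hc⟩⟩ ⟨⟨a', ha'⟩, ⟨b', hb'⟩, ⟨c', hc'⟩⟩ he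
    simp only [F] at he
    have hrel : (a'⁻¹ * a) * (b'⁻¹ * b) * (c'⁻¹ * c) = 1 := by
      letI : CommGroup (GLm p 1) := { toGroup := inferInstance, mul_comm := glOne_comm }
      calc (a'⁻¹ * a) * (b'⁻¹ * b) * (c'⁻¹ * c) = (a' * b' * c')⁻¹ * (a * b * c) := by
            rw [mul_inv_rev, mul_inv_rev]; ac_rfl
        _ = 1 := by rw [he, inv_mul_cancel]
    obtain ⟨h1, h2, h3⟩ := htpp _ (H₁.mul_mem (H₁.inv_mem ha') ha) _ (H₂.mul_mem (H₂.inv_mem hb') hb)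
      _ (H₃.mul_mem (H₃.inv_mem hc') hc) hrel
    rw [inv_mul_eq_one] at h1 h2 h3
    subst h1 h2 h3
    rfl
  have := Nat.card_le_card_of_injective F hF
  simpa [Nat.card_prod, mul_assoc] using this

/-- **No subgroup identity design in `GL_1(𝔽_p)` at any `0 < ε ≤ 1`:** level `0` is dead, and for
`k ≥ 1` the budget is the full one, `|G| ≥ V ≥ V^{(2+ε)/3}`. -/
theorem no_design_matOne {ε : ℝ} (_hε : 0 < ε) (hε1 : ε ≤ 1) (htpp : SubgroupTPP H₁ H₂ H₃)
    (htest : IdTest k H₁ H₂ H₃) : ¬ budget p 1 k (2 + ε) < vol H₁ H₂ H₃ ^ ((2 + ε) / 3) := by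
  intro hlt
  rcases Nat.eq_zero_or_pos k with rfl | hk
  · exact not_lt_of_vol_eq_one (vol_eq_one_of_idTest_zero htest) hlt
  · rw [budget_matOne hk] at hlt
    have h1 := vol_rpow_le_vol hε1 H₁ H₂ H₃
    have h2 : vol H₁ H₂ H₃ ≤ Fintype.card (GLm p 1) := by
      unfold vol; rw [← Nat.card_eq_fintype_card]; exact_mod_cast vol_le_card_matOne htpp
    linarith

end MatOne

/-- **STRENGTHENING REFUTED (`m = 1`).**  The abelian slice `m = 1` of `SubgroupIdentityDesigns` is
false (already at `ε = 1`).  Every witness has `m ≥ 2` and `k ≥ 1`. -/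
theorem not_subgroupIdentityDesigns_matOne :
    ¬ (∀ ε : ℝ, 0 < ε → ∃ (p : ℕ) (_ : Fact p.Prime) (k : ℕ) (H₁ H₂ H₃ : Subgroup (GLm p 1)),
        SubgroupTPP H₁ H₂ H₃ ∧ IdTest k H₁ H₂ H₃ ∧ budget p 1 k (2 + ε) < vol H₁ H₂ H₃ ^ ((2 + ε) / 3)) := by
  intro h
  obtain ⟨p, hp, k, H₁, H₂, H₃, htpp, htest, hlt⟩ := h 1 one_pos
  exact no_design_matOne one_pos le_rfl htpp htest hlt

/-! ## (gen 2) PAIR INDEPENDENCE, SLAB SUPPORT, TENSOR CIRCUITS, MIDDLE CRITERION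
(abstract forms landed as `Theorems/SubgroupIdentityDesigns/Negative/PairIndependence.lean`, p115936) -/

section PairIndependence

variable {G : Type} [Group G] [Fintype G]

omit [Fintype G] in
/-- **Pair read-out (outer pair).**  Under the subgroup TPP an identity test `f` reads, after the
two-sided translation by `(a, c) ∈ H₁ × H₃`, the delta function at `a c` on the whole product set:
`f (a⁻¹ (a' b c') c⁻¹) = [a' b c' = a c]`. -/
theorem probe_outer_apply {H₁ H₂ H₃ : Subgroup G} (htpp : SubgroupTPP H₁ H₂ H₃)
    {f : G → ℂ} (h1 : f 1 = 1)
    (h0 : ∀ a ∈ H₁, ∀ b ∈ H₂, ∀ c ∈ H₃, a * b * c ≠ 1 → f (a * b * c) = 0)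
    {a c a' b c' : G} (ha : a ∈ H₁) (hc : c ∈ H₃) (ha' : a' ∈ H₁) (hb : b ∈ H₂) (hc' : c' ∈ H₃) :
    f (a⁻¹ * (a' * b * c') * c⁻¹) = if a' * b * c' = a * c then 1 else 0 := by
  have key : a⁻¹ * (a' * b * c') * c⁻¹ = (a⁻¹ * a') * b * (c' * c⁻¹) := by group
  rw [key, idTest_apply_eq_ite htpp h1 h0 (H₁.mul_mem (H₁.inv_mem ha) ha') hb
    (H₃.mul_mem hc' (H₃.inv_mem hc))]
  by_cases h : a' * b * c' = a * c
  · -- then `(a⁻¹a') b (c'c⁻¹) = 1`, so all three factors are trivial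
    have e : (a⁻¹ * a') * b * (c' * c⁻¹) = 1 := by
      calc (a⁻¹ * a') * b * (c' * c⁻¹) = a⁻¹ * (a' * b * c') * c⁻¹ := by group
        _ = 1 := by rw [h]; group
    obtain ⟨e1, e2, e3⟩ := htpp _ (H₁.mul_mem (H₁.inv_mem ha) ha') _ hb _
      (H₃.mul_mem hc' (H₃.inv_mem hc)) e
    rw [if_pos ⟨e1, e2, e3⟩, if_pos h]
  · rw [if_neg h, if_neg]
    rintro ⟨e1, e2, e3⟩
    apply h
    have ha1 : a' = a := by
      calc a' = a * (a⁻¹ * a') := by group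
        _ = a := by rw [e1, mul_one]
    have hc1 : c' = c := by
      calc c' = (c' * c⁻¹) * c := by group
        _ = c := by rw [e3, one_mul]
    rw [ha1, e2, hc1, mul_one]

/-- **(I2) Annihilators supported on the product set vanish on the outer double coset `H₁H₃`.**
For a bi-invariant `J ≤ ℂ^G`, a subgroup TPP triple with an identity test `f ∈ J`, and any
`λ : G → ℂ` supported on `H₁H₂H₃` and orthogonal to `J` (`Σ_y λ(y) F(y) = 0` for all `F ∈ J`):
`λ(a c) = 0` for all `a ∈ H₁`, `c ∈ H₃` — in particular `λ(1) = 0` (the dual form of the test) and,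
more strongly, `λ` lives on the slabs `H₁ (H₂ ∖ 1) H₃` only. -/
theorem annihilator_apply_outer_eq_zero (J : Submodule ℂ (G → ℂ))
    (hJ : ∀ f ∈ J, ∀ a b : G, (fun g : G => f (a * g * b)) ∈ J)
    {H₁ H₂ H₃ : Subgroup G} (htpp : SubgroupTPP H₁ H₂ H₃)
    {f : G → ℂ} (hf : f ∈ J) (h1 : f 1 = 1)
    (h0 : ∀ a ∈ H₁, ∀ b ∈ H₂, ∀ c ∈ H₃, a * b * c ≠ 1 → f (a * b * c) = 0)
    (lam : G → ℂ) (hsupp : ∀ y, lam y ≠ 0 → ∃ a ∈ H₁, ∃ b ∈ H₂, ∃ c ∈ H₃, y = a * b * c)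
    (hann : ∀ F ∈ J, ∑ y, lam y * F y = 0)
    {a c : G} (ha : a ∈ H₁) (hc : c ∈ H₃) : lam (a * c) = 0 := by
  classical
  have h := hann _ (hJ f hf a⁻¹ c⁻¹)
  -- the probe is `δ_{ac}` on the support of `λ`
  have hterm : ∀ y, lam y * f (a⁻¹ * y * c⁻¹) = if y = a * c then lam (a * c) else 0 := by
    intro y
    by_cases hy : lam y = 0
    · rw [hy, zero_mul]
      split_ifs with e
      · rw [← e, hy]
      · rfl
    · obtain ⟨a', ha', b, hb, c', hc', rfl⟩ := hsupp y hy
      rw [probe_outer_apply htpp h1 h0 ha hc ha' hb hc']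
      split_ifs with e
      · rw [mul_one, e]
      · rw [mul_zero]
  simp only [hterm, Finset.sum_ite_eq', Finset.mem_univ, if_true] at h
  exact h

/-- **(I1) The outer double coset `H₁H₃` is `J`-independent**: a function supported on `H₁H₃` and
orthogonal to `J` is zero.  Equivalently `J|_{H₁H₃} = ℂ^{H₁H₃}` — the restriction of the test space to
the `|H₁||H₃|` points `a c` is everything (this sharpens the wall `|H₁||H₃| ≤ dim J` from a count to
a structural statement: the evaluation functionals at the points of `H₁H₃` are linearly independent
on `J`). -/
theorem eq_zero_of_annihilator_on_outer (J : Submodule ℂ (G → ℂ))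
    (hJ : ∀ f ∈ J, ∀ a b : G, (fun g : G => f (a * g * b)) ∈ J)
    {H₁ H₂ H₃ : Subgroup G} (htpp : SubgroupTPP H₁ H₂ H₃)
    {f : G → ℂ} (hf : f ∈ J) (h1 : f 1 = 1)
    (h0 : ∀ a ∈ H₁, ∀ b ∈ H₂, ∀ c ∈ H₃, a * b * c ≠ 1 → f (a * b * c) = 0)
    (lam : G → ℂ) (hsupp : ∀ y, lam y ≠ 0 → ∃ a ∈ H₁, ∃ c ∈ H₃, y = a * c)
    (hann : ∀ F ∈ J, ∑ y, lam y * F y = 0) : lam = 0 := by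
  funext y
  by_contra hy
  obtain ⟨a, ha, c, hc, rfl⟩ := hsupp y hy
  exact hy (annihilator_apply_outer_eq_zero J hJ htpp hf h1 h0 lam
    (fun y hy' => by
      obtain ⟨a', ha', c', hc', rfl⟩ := hsupp y hy'
      exact ⟨a', ha', 1, H₂.one_mem, c', hc', by rw [mul_one]⟩) hann ha hc)

/-- **(I1, left pair) `H₁H₂` is `J`-independent** (probes `g ↦ f(a⁻¹ g b⁻¹)` read `δ_{ab}` on `H₁H₂`). -/
theorem eq_zero_of_annihilator_on_left (J : Submodule ℂ (G → ℂ))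
    (hJ : ∀ f ∈ J, ∀ a b : G, (fun g : G => f (a * g * b)) ∈ J)
    {H₁ H₂ H₃ : Subgroup G} (htpp : SubgroupTPP H₁ H₂ H₃)
    {f : G → ℂ} (hf : f ∈ J) (h1 : f 1 = 1)
    (h0 : ∀ a ∈ H₁, ∀ b ∈ H₂, ∀ c ∈ H₃, a * b * c ≠ 1 → f (a * b * c) = 0)
    (lam : G → ℂ) (hsupp : ∀ y, lam y ≠ 0 → ∃ a ∈ H₁, ∃ b ∈ H₂, y = a * b)
    (hann : ∀ F ∈ J, ∑ y, lam y * F y = 0) : lam = 0 := by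
  classical
  funext y
  by_contra hy
  obtain ⟨a, ha, b, hb, rfl⟩ := hsupp _ hy
  have h := hann _ (hJ f hf a⁻¹ b⁻¹)
  have hread : ∀ a' ∈ H₁, ∀ b' ∈ H₂, f (a⁻¹ * (a' * b') * b⁻¹) = if a' * b' = a * b then 1 else 0 := by
    intro a' ha' b' hb'
    have key : a⁻¹ * (a' * b') * b⁻¹ = (a⁻¹ * a') * (b' * b⁻¹) * 1 := by group
    rw [key, idTest_apply_eq_ite htpp h1 h0 (H₁.mul_mem (H₁.inv_mem ha) ha')
      (H₂.mul_mem hb' (H₂.inv_mem hb)) H₃.one_mem]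
    by_cases e : a' * b' = a * b
    · have e' : a⁻¹ * a' * (b' * b⁻¹) * 1 = 1 := by
        calc a⁻¹ * a' * (b' * b⁻¹) * 1 = a⁻¹ * (a' * b') * b⁻¹ := by group
          _ = 1 := by rw [e]; group
      obtain ⟨e1, e2, -⟩ := htpp _ (H₁.mul_mem (H₁.inv_mem ha) ha') _
        (H₂.mul_mem hb' (H₂.inv_mem hb)) _ H₃.one_mem e'
      rw [if_pos ⟨e1, e2, rfl⟩, if_pos e]
    · rw [if_neg e, if_neg]
      rintro ⟨e1, e2, -⟩
      apply e
      have : a' = a := by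
        calc a' = a * (a⁻¹ * a') := by group
          _ = a := by rw [e1, mul_one]
      have hb1 : b' = b := by
        calc b' = (b' * b⁻¹) * b := by group
          _ = b := by rw [e2, one_mul]
      rw [this, hb1]
  have hterm : ∀ y, lam y * f (a⁻¹ * y * b⁻¹) = if y = a * b then lam (a * b) else 0 := by
    intro y
    by_cases hy0 : lam y = 0
    · rw [hy0, zero_mul]
      split_ifs with e
      · rw [← e, hy0]
      · rfl
    · obtain ⟨a', ha', b', hb', rfl⟩ := hsupp y hy0
      rw [hread a' ha' b' hb']
      split_ifs with e
      · rw [mul_one, e]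
      · rw [mul_zero]
  simp only [hterm, Finset.sum_ite_eq', Finset.mem_univ, if_true] at h
  exact hy h

/-- **(I1, right pair) `H₂H₃` is `J`-independent** (probes `g ↦ f(b⁻¹ g c⁻¹)` read `δ_{bc}` on `H₂H₃`). -/
theorem eq_zero_of_annihilator_on_right (J : Submodule ℂ (G → ℂ))
    (hJ : ∀ f ∈ J, ∀ a b : G, (fun g : G => f (a * g * b)) ∈ J)
    {H₁ H₂ H₃ : Subgroup G} (htpp : SubgroupTPP H₁ H₂ H₃)
    {f : G → ℂ} (hf : f ∈ J) (h1 : f 1 = 1)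
    (h0 : ∀ a ∈ H₁, ∀ b ∈ H₂, ∀ c ∈ H₃, a * b * c ≠ 1 → f (a * b * c) = 0)
    (lam : G → ℂ) (hsupp : ∀ y, lam y ≠ 0 → ∃ b ∈ H₂, ∃ c ∈ H₃, y = b * c)
    (hann : ∀ F ∈ J, ∑ y, lam y * F y = 0) : lam = 0 := by
  classical
  funext y
  by_contra hy
  obtain ⟨b, hb, c, hc, rfl⟩ := hsupp _ hy
  have h := hann _ (hJ f hf b⁻¹ c⁻¹)
  have hread : ∀ b' ∈ H₂, ∀ c' ∈ H₃, f (b⁻¹ * (b' * c') * c⁻¹) = if b' * c' = b * c then 1 else 0 := by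
    intro b' hb' c' hc'
    have key : b⁻¹ * (b' * c') * c⁻¹ = 1 * (b⁻¹ * b') * (c' * c⁻¹) := by group
    rw [key, idTest_apply_eq_ite htpp h1 h0 H₁.one_mem (H₂.mul_mem (H₂.inv_mem hb) hb')
      (H₃.mul_mem hc' (H₃.inv_mem hc))]
    by_cases e : b' * c' = b * c
    · have e' : 1 * (b⁻¹ * b') * (c' * c⁻¹) = 1 := by
        calc 1 * (b⁻¹ * b') * (c' * c⁻¹) = b⁻¹ * (b' * c') * c⁻¹ := by group
          _ = 1 := by rw [e]; group
      obtain ⟨-, e2, e3⟩ := htpp _ H₁.one_mem _ (H₂.mul_mem (H₂.inv_mem hb) hb') _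
        (H₃.mul_mem hc' (H₃.inv_mem hc)) e'
      rw [if_pos ⟨rfl, e2, e3⟩, if_pos e]
    · rw [if_neg e, if_neg]
      rintro ⟨-, e2, e3⟩
      apply e
      have hb1 : b' = b := by
        calc b' = b * (b⁻¹ * b') := by group
          _ = b := by rw [e2, mul_one]
      have hc1 : c' = c := by
        calc c' = (c' * c⁻¹) * c := by group
          _ = c := by rw [e3, one_mul]
      rw [hb1, hc1]
  have hterm : ∀ y, lam y * f (b⁻¹ * y * c⁻¹) = if y = b * c then lam (b * c) else 0 := by
    intro y
    by_cases hy0 : lam y = 0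
    · rw [hy0, zero_mul]
      split_ifs with e
      · rw [← e, hy0]
      · rfl
    · obtain ⟨b', hb', c', hc', rfl⟩ := hsupp y hy0
      rw [hread b' hb' c' hc']
      split_ifs with e
      · rw [mul_one, e]
      · rw [mul_zero]
  simp only [hterm, Finset.sum_ite_eq', Finset.mem_univ, if_true] at h
  exact hy h

/-- **(M11) The bi-averaged identity test.**  Under the subgroup TPP, an identity test `f ∈ J`
yields the `H₁`-left / `H₃`-right invariant function `F(g) = Σ_{a ∈ H₁} Σ_{c ∈ H₃} f(a g c)` in `J`, which
reads `F(b) = [b = 1]` on the middle group: `F(1) = 1` and `F(b) = 0` for `b ∈ H₂ ∖ 1`.  (The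
trivial-isotype component of the test; a cheap necessary condition: `δ_1|_{H₂}` must lie in the
restriction to `H₂` of the `H₁ × H₃`-bi-invariant part of `J`.) -/
theorem exists_biInv_test_on_mid (J : Submodule ℂ (G → ℂ))
    (hJ : ∀ f ∈ J, ∀ a b : G, (fun g : G => f (a * g * b)) ∈ J)
    {H₁ H₂ H₃ : Subgroup G} (htpp : SubgroupTPP H₁ H₂ H₃)
    {f : G → ℂ} (hf : f ∈ J) (h1 : f 1 = 1)
    (h0 : ∀ a ∈ H₁, ∀ b ∈ H₂, ∀ c ∈ H₃, a * b * c ≠ 1 → f (a * b * c) = 0) :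
    ∃ F ∈ J, (∀ a ∈ H₁, ∀ c ∈ H₃, ∀ g, F (a * g * c) = F g) ∧ F 1 = 1 ∧ ∀ b ∈ H₂, b ≠ 1 → F b = 0 := by
  classical
  let F : G → ℂ := fun g => ∑ a : H₁, ∑ c : H₃, f ((a : G) * g * (c : G))
  have hF : F ∈ J := by
    have : F = ∑ a : H₁, ∑ c : H₃, fun g => f ((a : G) * g * (c : G)) := by
      funext g; simp only [F, Finset.sum_apply]
    rw [this]
    exact Submodule.sum_mem _ fun a _ => Submodule.sum_mem _ fun c _ => hJ f hf _ _
  -- read-out on the middle group: `F b = #{(a,c) : a b c = 1} = [b = 1]`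
  have hread : ∀ b ∈ H₂, F b = if b = 1 then 1 else 0 := by
    intro b hb
    simp only [F]
    have hterm : ∀ (a : H₁) (c : H₃), f ((a : G) * b * (c : G)) =
        if (a : G) = 1 ∧ b = 1 ∧ (c : G) = 1 then 1 else 0 := fun a c =>
      idTest_apply_eq_ite htpp h1 h0 a.2 hb c.2
    simp_rw [hterm]
    by_cases hb1 : b = 1
    · subst hb1
      rw [if_pos rfl]
      rw [Finset.sum_eq_single (⟨1, H₁.one_mem⟩ : H₁)]
      · rw [Finset.sum_eq_single (⟨1, H₃.one_mem⟩ : H₃)]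
        · simp
        · intro c _ hc
          rw [if_neg]
          rintro ⟨-, -, e⟩
          exact hc (Subtype.ext e)
        · intro h; exact absurd (Finset.mem_univ _) h
      · intro a _ ha
        refine Finset.sum_eq_zero fun c _ => ?_
        rw [if_neg]
        rintro ⟨e, -, -⟩
        exact ha (Subtype.ext e)
      · intro h; exact absurd (Finset.mem_univ _) h
    · rw [if_neg hb1]
      refine Finset.sum_eq_zero fun a _ => Finset.sum_eq_zero fun c _ => ?_
      rw [if_neg]
      rintro ⟨-, e, -⟩
      exact hb1 e
  refine ⟨F, hF, ?_, ?_, ?_⟩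
  · -- bi-invariance: reindex `a' ↦ a' a`, `c' ↦ c c'`
    intro a ha c hc g
    simp only [F]
    have e1 : ∀ a' : H₁, ∑ c' : H₃, f ((a' : G) * (a * g * c) * (c' : G)) =
        ∑ c' : H₃, f (((a' : G) * a) * g * (c * (c' : G))) := fun a' =>
      Finset.sum_congr rfl fun c' _ => by congr 1; group
    simp_rw [e1]
    -- reindex the inner sum by left multiplication by `c` in `H₃`
    have e2 : ∀ x : G, ∑ c' : H₃, f (x * g * (c * (c' : G))) = ∑ c' : H₃, f (x * g * (c' : G)) := by
      intro x
      exact Fintype.sum_equiv (Equiv.mulLeft (⟨c, hc⟩ : H₃)) _ _ fun c' => rfl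
    simp_rw [e2]
    exact Fintype.sum_equiv (Equiv.mulRight (⟨a, ha⟩ : H₁)) _ _ fun a' => rfl
  · rw [hread 1 H₂.one_mem, if_pos rfl]
  · intro b hb hb1
    rw [hread b hb, if_neg hb1]

end PairIndependence

/-! ### Crux forms: Fourier circuits on the pairs kill the identity test -/

section CruxPairs

variable {p m : ℕ} [Fact p.Prime] {k : ℕ} {H₁ H₂ H₃ : Subgroup (GLm p m)}

/-- Fourier form of orthogonality to `F_k|_G`: if `Σ_y λ(y) ψ(tr(M y)) = 0` for every matrix `M` of
rank `≤ k`, then `λ ⊥ F_k|_G`. -/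
theorem annihilates_level_of_fourier (lam : GLm p m → ℂ)
    (h : ∀ M : Mat p m, M.rank ≤ k →
      ∑ y : GLm p m, lam y * ZMod.stdAddChar (Matrix.trace (M * (y : Mat p m))) = 0) :
    ∀ F ∈ levelSubmodule p m k, ∑ y, lam y * F y = 0 := by
  intro F hF
  obtain ⟨c, hc, hFc⟩ := mem_levelSubmodule_iff.1 hF
  simp_rw [hFc, fourierFn, Finset.mul_sum]
  rw [Finset.sum_comm]
  refine Finset.sum_eq_zero fun M _ => ?_
  have e : ∑ y : GLm p m, lam y * (c M * ZMod.stdAddChar (Matrix.trace (M * (y : Mat p m)))) =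
      c M * ∑ y : GLm p m, lam y * ZMod.stdAddChar (Matrix.trace (M * (y : Mat p m))) := by
    rw [Finset.mul_sum]
    exact Finset.sum_congr rfl fun y _ => by ring
  rw [e]
  by_cases hM : M.rank ≤ k
  · rw [h M hM, mul_zero]
  · rw [hc M (not_le.mp hM), zero_mul]

/-- **OUTER PAIR INDEPENDENCE (crux form).**  A level-`k` subgroup identity design has `H₁H₃`
`F_k`-independent: the only function on the points `a c` (`a ∈ H₁, c ∈ H₃`) all of whose level-`k`
Fourier sums `Σ_y λ(y) ψ(tr(M y))` (`rk M ≤ k`) vanish is `λ = 0`.  Equivalently the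
`|H₁||H₃| × N_k` character matrix `[ψ(tr(M·ac))]` has full row rank `|H₁||H₃|` (a structural
sharpening of the wall `|H₁||H₃| ≤ dim F_k`; no reference to the middle group). -/
theorem outer_pair_independent (htpp : SubgroupTPP H₁ H₂ H₃) (htest : IdTest k H₁ H₂ H₃)
    (lam : GLm p m → ℂ) (hsupp : ∀ y, lam y ≠ 0 → ∃ a ∈ H₁, ∃ c ∈ H₃, y = a * c)
    (hfour : ∀ M : Mat p m, M.rank ≤ k →
      ∑ y : GLm p m, lam y * ZMod.stdAddChar (Matrix.trace (M * (y : Mat p m))) = 0) : lam = 0 := by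
  obtain ⟨f, hf, h1, h0⟩ := idTest_iff.1 htest
  exact eq_zero_of_annihilator_on_outer (levelSubmodule p m k) levelSubmodule_biInv htpp hf h1 h0 lam
    hsupp (annihilates_level_of_fourier lam hfour)

/-- **LEFT PAIR INDEPENDENCE (crux form)**: `H₁H₂` is `F_k`-independent. -/
theorem left_pair_independent (htpp : SubgroupTPP H₁ H₂ H₃) (htest : IdTest k H₁ H₂ H₃)
    (lam : GLm p m → ℂ) (hsupp : ∀ y, lam y ≠ 0 → ∃ a ∈ H₁, ∃ b ∈ H₂, y = a * b)
    (hfour : ∀ M : Mat p m, M.rank ≤ k →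
      ∑ y : GLm p m, lam y * ZMod.stdAddChar (Matrix.trace (M * (y : Mat p m))) = 0) : lam = 0 := by
  obtain ⟨f, hf, h1, h0⟩ := idTest_iff.1 htest
  exact eq_zero_of_annihilator_on_left (levelSubmodule p m k) levelSubmodule_biInv htpp hf h1 h0 lam
    hsupp (annihilates_level_of_fourier lam hfour)

/-- **RIGHT PAIR INDEPENDENCE (crux form)**: `H₂H₃` is `F_k`-independent. -/
theorem right_pair_independent (htpp : SubgroupTPP H₁ H₂ H₃) (htest : IdTest k H₁ H₂ H₃)
    (lam : GLm p m → ℂ) (hsupp : ∀ y, lam y ≠ 0 → ∃ b ∈ H₂, ∃ c ∈ H₃, y = b * c)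
    (hfour : ∀ M : Mat p m, M.rank ≤ k →
      ∑ y : GLm p m, lam y * ZMod.stdAddChar (Matrix.trace (M * (y : Mat p m))) = 0) : lam = 0 := by
  obtain ⟨f, hf, h1, h0⟩ := idTest_iff.1 htest
  exact eq_zero_of_annihilator_on_right (levelSubmodule p m k) levelSubmodule_biInv htpp hf h1 h0 lam
    hsupp (annihilates_level_of_fourier lam hfour)

/-- **SLAB SUPPORT (crux form).**  Every level-`k` annihilator supported on the product set
`H₁H₂H₃` of a design vanishes on the slab `H₁ · 1 · H₃`: the `|P| − dim F_k|_P` linear relations among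
the evaluations live on `H₁ (H₂ ∖ 1) H₃` only.  (Dual form of the identity test: the test holds iff
no annihilator on `P` has `λ(1) ≠ 0`.) -/
theorem annihilator_vanishes_on_slab (htpp : SubgroupTPP H₁ H₂ H₃) (htest : IdTest k H₁ H₂ H₃)
    (lam : GLm p m → ℂ) (hsupp : ∀ y, lam y ≠ 0 → ∃ a ∈ H₁, ∃ b ∈ H₂, ∃ c ∈ H₃, y = a * b * c)
    (hfour : ∀ M : Mat p m, M.rank ≤ k →
      ∑ y : GLm p m, lam y * ZMod.stdAddChar (Matrix.trace (M * (y : Mat p m))) = 0)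
    {a c : GLm p m} (ha : a ∈ H₁) (hc : c ∈ H₃) : lam (a * c) = 0 := by
  obtain ⟨f, hf, h1, h0⟩ := idTest_iff.1 htest
  exact annihilator_apply_outer_eq_zero (levelSubmodule p m k) levelSubmodule_biInv htpp hf h1 h0 lam
    hsupp (annihilates_level_of_fourier lam hfour) ha hc

/-- **DUAL CRITERION (packaged).**  An explicit level-`k` annihilator on the product set that does not
vanish at `1` kills the identity test: to refute a candidate `(H₁,H₂,H₃)` at level `k` it suffices to
exhibit weights `λ` on `H₁H₂H₃` with `λ(1) ≠ 0` and `Σ_y λ(y) ψ(tr(M y)) = 0` for every `M` of rank `≤ k`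
(TorusCube's signed cube and the cuspidal projections behind the three-Borel failures are instances). -/
theorem no_idTest_of_annihilator (htpp : SubgroupTPP H₁ H₂ H₃) (lam : GLm p m → ℂ)
    (hsupp : ∀ y, lam y ≠ 0 → ∃ a ∈ H₁, ∃ b ∈ H₂, ∃ c ∈ H₃, y = a * b * c)
    (hfour : ∀ M : Mat p m, M.rank ≤ k →
      ∑ y : GLm p m, lam y * ZMod.stdAddChar (Matrix.trace (M * (y : Mat p m))) = 0)
    (h1 : lam 1 ≠ 0) : ¬ IdTest k H₁ H₂ H₃ := fun htest =>
  h1 (by simpa using annihilator_vanishes_on_slab htpp htest lam hsupp hfour H₁.one_mem H₃.one_mem)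

/-- **TENSOR CIRCUIT (outer pair).**  If two weight functions `θ₁, θ₃` with `θ₁(1) θ₃(1) ≠ 0` (e.g.
linear characters of `H₁`, `H₃`) have ALL level-`k` pair sums vanishing,
`Σ_{a ∈ H₁} Σ_{c ∈ H₃} θ₁(a) θ₃(c) ψ(tr(M a c)) = 0` for every `M` of rank `≤ k`, then `(H₁, H₂, H₃)` admits
NO level-`k` identity test, whatever the middle group `H₂` (given the TPP).  For characters the
vanishing at `M = U Vᵀ` says: on every fibre `{c : c U = c₀ U}` (a coset of `H₃ ∩ Fix(col U)`) `θ₃` sums to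
zero, or dually for `θ₁` — "no `k`-frame is good for `θ₁` and `θ₃` simultaneously". -/
theorem no_idTest_of_pair_circuit (htpp : SubgroupTPP H₁ H₂ H₃) (θ₁ θ₃ : GLm p m → ℂ)
    (hθ : θ₁ 1 * θ₃ 1 ≠ 0)
    (hvan : ∀ M : Mat p m, M.rank ≤ k →
      ∑ a : H₁, ∑ c : H₃, θ₁ a * θ₃ c *
        ZMod.stdAddChar (Matrix.trace (M * (((a : GLm p m) * (c : GLm p m) : GLm p m) : Mat p m))) = 0) :
    ¬ IdTest k H₁ H₂ H₃ := by
  classical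
  intro htest
  -- the tensor weight on `H₁H₃` (unique factorisation by `H₁ ∩ H₃ = 1`)
  let lam : GLm p m → ℂ := fun y => ∑ a : H₁, ∑ c : H₃, if y = (a : GLm p m) * c then θ₁ a * θ₃ c else 0
  have h13 : ∀ a ∈ H₁, ∀ c ∈ H₃, a * c = 1 → a = 1 ∧ c = 1 := fun a ha c hc e => by
    obtain ⟨e1, -, e3⟩ := htpp a ha 1 H₂.one_mem c hc (by simpa using e)
    exact ⟨e1, e3⟩
  have huniq : ∀ (a a' : H₁) (c c' : H₃), (a : GLm p m) * c = (a' : GLm p m) * c' → a = a' ∧ c = c' := by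
    intro a a' c c' e
    have e' : ((a' : GLm p m)⁻¹ * a) * ((c : GLm p m) * (c' : GLm p m)⁻¹) = 1 := by
      calc ((a' : GLm p m)⁻¹ * a) * ((c : GLm p m) * (c' : GLm p m)⁻¹)
          = (a' : GLm p m)⁻¹ * ((a : GLm p m) * c) * (c' : GLm p m)⁻¹ := by group
        _ = 1 := by rw [e]; group
    obtain ⟨e1, e3⟩ := h13 _ (H₁.mul_mem (H₁.inv_mem a'.2) a.2) _ (H₃.mul_mem c.2 (H₃.inv_mem c'.2)) e'
    refine ⟨Subtype.ext ?_, Subtype.ext ?_⟩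
    · calc (a : GLm p m) = a' * ((a' : GLm p m)⁻¹ * a) := by group
        _ = a' := by rw [e1, mul_one]
    · calc (c : GLm p m) = ((c : GLm p m) * (c' : GLm p m)⁻¹) * c' := by group
        _ = c' := by rw [e3, one_mul]
  have hlam : ∀ (a : H₁) (c : H₃), lam ((a : GLm p m) * c) = θ₁ a * θ₃ c := by
    intro a c
    simp only [lam]
    rw [Finset.sum_eq_single a]
    · rw [Finset.sum_eq_single c]
      · rw [if_pos rfl]
      · intro c' _ hc'
        rw [if_neg]
        intro e
        exact hc' (huniq a a c c' e).2.symm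
      · intro h; exact absurd (Finset.mem_univ _) h
    · intro a' _ ha'
      refine Finset.sum_eq_zero fun c' _ => ?_
      rw [if_neg]
      intro e
      exact ha' (huniq a a' c c' e).1.symm
    · intro h; exact absurd (Finset.mem_univ _) h
  have hsupp : ∀ y, lam y ≠ 0 → ∃ a ∈ H₁, ∃ c ∈ H₃, y = a * c := by
    intro y hy
    by_contra hne
    push Not at hne
    apply hy
    refine Finset.sum_eq_zero fun a _ => Finset.sum_eq_zero fun c _ => ?_
    rw [if_neg (hne a a.2 c c.2)]
  have hfour : ∀ M : Mat p m, M.rank ≤ k →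
      ∑ y : GLm p m, lam y * ZMod.stdAddChar (Matrix.trace (M * (y : Mat p m))) = 0 := by
    intro M hM
    have e : ∀ y : GLm p m, lam y * ZMod.stdAddChar (Matrix.trace (M * (y : Mat p m))) =
        ∑ a : H₁, ∑ c : H₃, if y = (a : GLm p m) * c then
          θ₁ a * θ₃ c * ZMod.stdAddChar (Matrix.trace (M * (y : Mat p m))) else 0 := by
      intro y
      simp only [lam, Finset.sum_mul]
      refine Finset.sum_congr rfl fun a _ => Finset.sum_congr rfl fun c _ => ?_
      split_ifs <;> simp
    calc ∑ y : GLm p m, lam y * ZMod.stdAddChar (Matrix.trace (M * (y : Mat p m)))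
        = ∑ y : GLm p m, ∑ a : H₁, ∑ c : H₃, (if y = (a : GLm p m) * c then
            θ₁ a * θ₃ c * ZMod.stdAddChar (Matrix.trace (M * (y : Mat p m))) else 0) :=
          Finset.sum_congr rfl fun y _ => e y
      _ = ∑ a : H₁, ∑ y : GLm p m, ∑ c : H₃, (if y = (a : GLm p m) * c then
            θ₁ a * θ₃ c * ZMod.stdAddChar (Matrix.trace (M * (y : Mat p m))) else 0) :=
          Finset.sum_comm
      _ = ∑ a : H₁, ∑ c : H₃, ∑ y : GLm p m, (if y = (a : GLm p m) * c then
            θ₁ a * θ₃ c * ZMod.stdAddChar (Matrix.trace (M * (y : Mat p m))) else 0) :=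
          Finset.sum_congr rfl fun a _ => Finset.sum_comm
      _ = ∑ a : H₁, ∑ c : H₃, θ₁ a * θ₃ c *
            ZMod.stdAddChar (Matrix.trace (M * (((a : GLm p m) * (c : GLm p m) : GLm p m) : Mat p m))) := by
          refine Finset.sum_congr rfl fun a _ => Finset.sum_congr rfl fun c _ => ?_
          rw [Finset.sum_ite_eq', if_pos (Finset.mem_univ _)]
      _ = 0 := hvan M hM
  have hz := outer_pair_independent htpp htest lam hsupp hfour
  have h11 := hlam ⟨1, H₁.one_mem⟩ ⟨1, H₃.one_mem⟩
  rw [hz] at h11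
  exact hθ (by simpa using h11.symm)

/-- **MIDDLE CRITERION (M11, crux form).**  A level-`k` subgroup identity design carries an
`H₁`-left/`H₃`-right INVARIANT level-`k` function reading `δ_1` on the middle group.  Unfolded:
`δ_1|_{H₂}` lies in the span of the functions `b ↦ #{(a, c) ∈ H₁ × H₃ : a b c ∈ C}`, `C` running over the
level-`k` cosets `Fix(W) x` — a linear system with only `|H₂|` unknowns (used as the cheap exact filter
of the census job of this file). -/
theorem mid_criterion (htpp : SubgroupTPP H₁ H₂ H₃) (htest : IdTest k H₁ H₂ H₃) :
    ∃ F ∈ levelSubmodule p m k, (∀ a ∈ H₁, ∀ c ∈ H₃, ∀ g, F (a * g * c) = F g) ∧ F 1 = 1 ∧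
      ∀ b ∈ H₂, b ≠ 1 → F b = 0 := by
  obtain ⟨f, hf, h1, h0⟩ := idTest_iff.1 htest
  exact exists_biInv_test_on_mid (levelSubmodule p m k) levelSubmodule_biInv htpp hf h1 h0

end CruxPairs


/-! ## (gen 2) THE TOP LEVEL `k ≥ m` TESTS NOTHING AND PRICES EVERYTHING
(Mathlib-only forms landed as `Theorems/SubgroupIdentityDesigns/Negative/TopLevel.lean`, p116037) -/

section TopLevel

variable {p m : ℕ} [Fact p.Prime]

/-- **Orthogonality on `M_m(𝔽_p)`**: `Σ_{M} ψ(tr(M D)) = p^{m·m} · [D = 0]`. [folklore] -/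
theorem sum_psi_trace_mul (D : Mat p m) :
    ∑ M : Mat p m, ZMod.stdAddChar (Matrix.trace (M * D)) =
      if D = 0 then ((p : ℂ) ^ (m * m)) else 0 := by
  classical
  have htr : ∀ M : Mat p m, ZMod.stdAddChar (Matrix.trace (M * D)) =
      ∏ i, ∏ j, ZMod.stdAddChar (D j i * M i j) := by
    intro M
    simp only [Matrix.trace, Matrix.diag_apply, Matrix.mul_apply]
    rw [stdAddChar_map_sum]
    refine Finset.prod_congr rfl fun i _ => ?_
    rw [stdAddChar_map_sum]
    exact Finset.prod_congr rfl fun j _ => by rw [mul_comm]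
  simp_rw [htr]
  have key : ∑ M : Mat p m, ∏ i, ∏ j, ZMod.stdAddChar (D j i * M i j) =
      ∏ i : Fin m, ∏ j : Fin m, ∑ x : ZMod p, ZMod.stdAddChar (D j i * x) := by
    calc ∑ M : Mat p m, ∏ i, ∏ j, ZMod.stdAddChar (D j i * M i j)
        = ∑ f : Fin m → Fin m → ZMod p, ∏ i, ∏ j, ZMod.stdAddChar (D j i * f i j) :=
          (Fintype.sum_equiv Matrix.of _ _ (fun f => rfl)).symm
      _ = ∏ i : Fin m, ∑ r : Fin m → ZMod p, ∏ j, ZMod.stdAddChar (D j i * r j) :=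
          (Fintype.prod_sum (fun (i : Fin m) (r : Fin m → ZMod p) =>
            ∏ j, ZMod.stdAddChar (D j i * r j))).symm
      _ = ∏ i : Fin m, ∏ j : Fin m, ∑ x : ZMod p, ZMod.stdAddChar (D j i * x) :=
          Finset.prod_congr rfl fun i _ =>
            (Fintype.prod_sum (fun (j : Fin m) (x : ZMod p) => ZMod.stdAddChar (D j i * x))).symm
  rw [key]
  simp_rw [sum_psi_mul]
  by_cases hD : D = 0
  · subst hD
    simp only [Matrix.zero_apply, if_true]
    simp only [Finset.prod_const, Finset.card_univ, Fintype.card_fin]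
    rw [← pow_mul]
  · rw [if_neg hD]
    -- some entry `D j i ≠ 0`
    obtain ⟨j, i, hji⟩ : ∃ j i, D j i ≠ 0 := by
      by_contra hne
      push Not at hne
      exact hD (Matrix.ext fun j i => hne j i)
    refine Finset.prod_eq_zero (Finset.mem_univ i) (Finset.prod_eq_zero (Finset.mem_univ j) ?_)
    rw [if_neg hji]

/-- `p^{m·m} ≠ 0` in `ℂ`. -/
theorem pow_card_ne_zero : ((p : ℂ) ^ (m * m)) ≠ 0 :=
  pow_ne_zero _ (Nat.cast_ne_zero.mpr (NeZero.ne p))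

/-- **Fourier inversion at the top level**: for `k ≥ m` every function on `GL_m(𝔽_p)` has level `k`
(all matrices have rank `≤ m ≤ k`, and the characters `ψ(tr(M·))` span `ℂ^{M_m(𝔽_p)} ⊇ ℂ^{GL_m}`). -/
theorem levelSet_eq_univ_of_le {k : ℕ} (hk : m ≤ k) : levelSet p m k = Set.univ := by
  classical
  refine Set.eq_univ_of_forall fun f => ?_
  have hN0 : ((p : ℂ) ^ (m * m)) ≠ 0 := pow_card_ne_zero
  refine ⟨fun M => ((p : ℂ) ^ (m * m))⁻¹ *
      ∑ h : GLm p m, f h * ZMod.stdAddChar (Matrix.trace (M * (-(h : Mat p m)))), ?_, fun g => ?_⟩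
  · intro M hM
    exfalso
    have := Matrix.rank_le_width M
    omega
  · unfold fourierFn
    have hexp : ∀ M : Mat p m,
        (((p : ℂ) ^ (m * m))⁻¹ *
            ∑ h : GLm p m, f h * ZMod.stdAddChar (Matrix.trace (M * (-(h : Mat p m))))) *
          ZMod.stdAddChar (Matrix.trace (M * (g : Mat p m))) =
        ((p : ℂ) ^ (m * m))⁻¹ *
          ∑ h : GLm p m, f h * ZMod.stdAddChar (Matrix.trace (M * ((g : Mat p m) - (h : Mat p m)))) := by
      intro M
      rw [mul_assoc, Finset.sum_mul]
      congr 1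
      refine Finset.sum_congr rfl fun h _ => ?_
      rw [mul_assoc, ← AddChar.map_add_eq_mul, ← Matrix.trace_add, ← Matrix.mul_add,
        neg_add_eq_sub]
    simp_rw [hexp]
    rw [← Finset.mul_sum, Finset.sum_comm]
    simp_rw [← Finset.mul_sum, sum_psi_trace_mul, sub_eq_zero]
    have hval : ∀ h : GLm p m,
        f h * (if ((g : Mat p m) = (h : Mat p m)) then ((p : ℂ) ^ (m * m)) else 0) =
        if g = h then f g * ((p : ℂ) ^ (m * m)) else 0 := by
      intro h
      by_cases hgh : g = h
      · subst hgh; rw [if_pos rfl, if_pos rfl]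
      · rw [if_neg (fun e => hgh (Units.ext e)), if_neg hgh, mul_zero]
    simp_rw [hval]
    rw [Finset.sum_ite_eq, if_pos (Finset.mem_univ _), ← mul_assoc, mul_comm (((p : ℂ) ^ (m * m))⁻¹),
      mul_assoc, inv_mul_cancel₀ hN0, mul_one]

/-- **At the top level the identity test is free**: for `k ≥ m`, `δ_1` itself has level `k`, so EVERY
subgroup triple passes (no TPP needed). -/
theorem idTest_of_le {k : ℕ} (hk : m ≤ k) (H₁ H₂ H₃ : Subgroup (GLm p m)) : IdTest k H₁ H₂ H₃ := by
  classical
  have hδ : (fun g : GLm p m => if g = 1 then (1 : ℂ) else 0) ∈ levelSet p m k := by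
    rw [levelSet_eq_univ_of_le hk]; trivial
  obtain ⟨c, hc, hfc⟩ := hδ
  refine ⟨c, hc, ?_, fun a _ b _ g _ hne => ?_⟩
  · rw [← hfc 1]; exact if_pos rfl
  · rw [← hfc (a * b * g)]; exact if_neg hne

/-- **At the top level the budget is the FULL character-degree sum** `Σ_{χ ∈ Irr} χ(1)^s`. -/
theorem budget_of_le {k : ℕ} (hk : m ≤ k) (s : ℝ) :
    budget p m k s = ∑ᶠ χ ∈ irrChars (GLm p m), (χ 1).re ^ s := by
  unfold budget
  rw [levelSet_eq_univ_of_le hk, Set.inter_univ]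

/-- **THE TOP-LEVEL SLICE IS THE CLASSICAL SUBGROUP COHN–UMANS PROBLEM.**  The sub-family `k ≥ m` of
`SubgroupIdentityDesigns` is equivalent to: for every `ε > 0` some `GL_m(𝔽_p)` carries a subgroup TPP
triple beating the FULL budget `Σ_{χ ∈ Irr GL_m(𝔽_p)} χ(1)^{2+ε}` — nothing graded is left, and the
tree's subgroup barriers (`SubgroupTPP.normalizer_barrier`, `center_barrier`: `V ≤ |G|^{3/2}/|Z|^{1/2}`)
and the quasirandom barrier at full budget apply verbatim.  A witness of the crux proper has `k < m`. -/
theorem topLevel_slice_iff :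
    (∀ ε : ℝ, 0 < ε → ∃ (p : ℕ) (_ : Fact p.Prime) (m k : ℕ) (H₁ H₂ H₃ : Subgroup (GLm p m)),
        m ≤ k ∧ SubgroupTPP H₁ H₂ H₃ ∧ IdTest k H₁ H₂ H₃ ∧
          budget p m k (2 + ε) < vol H₁ H₂ H₃ ^ ((2 + ε) / 3)) ↔
    (∀ ε : ℝ, 0 < ε → ∃ (p : ℕ) (_ : Fact p.Prime) (m : ℕ) (H₁ H₂ H₃ : Subgroup (GLm p m)),
        SubgroupTPP H₁ H₂ H₃ ∧
          (∑ᶠ χ ∈ irrChars (GLm p m), (χ 1).re ^ (2 + ε)) < vol H₁ H₂ H₃ ^ ((2 + ε) / 3)) := by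
  constructor
  · intro h ε hε
    obtain ⟨p, hp, m, k, H₁, H₂, H₃, hk, htpp, -, hlt⟩ := h ε hε
    exact ⟨p, hp, m, H₁, H₂, H₃, htpp, by rwa [budget_of_le hk] at hlt⟩
  · intro h ε hε
    obtain ⟨p, hp, m, H₁, H₂, H₃, htpp, hlt⟩ := h ε hε
    exact ⟨p, hp, m, m, H₁, H₂, H₃, le_rfl, htpp, idTest_of_le le_rfl H₁ H₂ H₃,
      by rwa [budget_of_le le_rfl]⟩

/-- **Every subgroup design, at any level, obeys BCGPU 2023 Cor. 3.8**:
`V² · |Z(GL_m(𝔽_p))| ≤ |GL_m(𝔽_p)|³` (tree theorem `SubgroupTPP.center_barrier_nat`, by the TPP alone). -/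
theorem vol_sq_mul_center_le (H₁ H₂ H₃ : Subgroup (GLm p m)) (htpp : SubgroupTPP H₁ H₂ H₃) :
    (Nat.card H₁ * Nat.card H₂ * Nat.card H₃) ^ 2 * Nat.card ↥(Subgroup.center (GLm p m)) ≤
      Nat.card (GLm p m) ^ 3 :=
  htpp.center_barrier_nat

end TopLevel


/-! ## (gen 2) WHAT REMAINS: the two-conjecture reduction of `¬ SubgroupIdentityDesigns` -/

section Reduction

/-- **GEN-1's CONJECTURE — REFUTED BY THE CENSUS (v6).**  "In the graded regime `k < m` the volume of a
subgroup identity design never exceeds the dimension of the test space, `|H₁||H₂||H₃| ≤ dim F_k|_G`."  FALSE: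
`GL_2(𝔽_5)`, `k = 1`: `H₁ = {diag(τ,1)}` (order 4), `H₂ = ⟨[[4,0],[1,1]]⟩` (order 4), `H₃ = ⟨[[0,1],[4,2]],[[1,3],[0,4]]⟩`
(order 10) is a subgroup TPP triple with a level-1 identity test and `V = 160 > 134 = dim F_1` (product set `|P| = 100`,
`F_1|_P = ℂ^P`); `GL_3(𝔽_2)`, `k = 2`: `(S₃, C₄, A₄)`-configurations with `V = 288 > 150` (evidence
`evidence-VgtD-witnesses.md` on the item; not formalised here — a `decide`/`native_decide` certificate is possible).
Kept as a `def` because `not_subgroupIdentityDesigns_of` below is stated over it. -/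
def VolumeLeDimConjecture : Prop :=
  ∀ (p : ℕ) [Fact p.Prime] (m k : ℕ) (H₁ H₂ H₃ : Subgroup (GLm p m)), k < m →
    SubgroupTPP H₁ H₂ H₃ → IdTest k H₁ H₂ H₃ →
      Nat.card H₁ * Nat.card H₂ * Nat.card H₃ ≤ Module.finrank ℂ (levelSubmodule p m k)

/-- **TOP-LEVEL HYPOTHESIS at exponent `2 + ε`**: no three TPP subgroups of any `GL_m(𝔽_p)` beat the FULL
budget `Σ_{χ ∈ Irr} χ(1)^{2+ε}` (the classical ungraded subgroup Cohn–Umans question at a fixed exponent;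
believed for small `ε` via quasirandomness of `GL_m(𝔽_p)`, BCGPU 2023 Cor 3.4/3.8, but not in the tree). -/
def NoTopLevelDesignAt (ε : ℝ) : Prop :=
  ∀ (p : ℕ) [Fact p.Prime] (m : ℕ) (H₁ H₂ H₃ : Subgroup (GLm p m)), SubgroupTPP H₁ H₂ H₃ →
    ¬ ((∑ᶠ χ ∈ irrChars (GLm p m), (χ 1).re ^ (2 + ε)) < vol H₁ H₂ H₃ ^ ((2 + ε) / 3))

/-- **THE REDUCTION (valid, but its first hypothesis is now known to be false — see above).**
`¬ SubgroupIdentityDesigns` follows from `VolumeLeDimConjecture` together with the top-level hypothesis at ONE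
exponent `2 + ε`, `0 < ε ≤ 1`: at that `ε`, a witness with `k < m` has
`V^{(2+ε)/3} ≤ V ≤ dim F_k ≤ budget` (graded Plancherel), and a witness with `k ≥ m` is a top-level design
(`budget_of_le`).  This is exactly what remains to kill the crux. -/
theorem not_subgroupIdentityDesigns_of (hV : VolumeLeDimConjecture) {ε : ℝ} (hε : 0 < ε) (hε1 : ε ≤ 1)
    (htop : NoTopLevelDesignAt ε) : ¬ SubgroupIdentityDesigns := by
  rw [subgroupIdentityDesigns_iff]
  intro h
  obtain ⟨p, hp, m, k, H₁, H₂, H₃, htpp, htest, hlt⟩ := h ε hε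
  rcases lt_or_ge k m with hkm | hkm
  · -- graded regime: V^{(2+ε)/3} ≤ V ≤ dim F_k ≤ budget
    have h1 : vol H₁ H₂ H₃ ≤ budget p m k (2 + ε) := by
      rw [budget_eq]
      calc vol H₁ H₂ H₃ = ((Nat.card H₁ * Nat.card H₂ * Nat.card H₃ : ℕ) : ℝ) := rfl
        _ ≤ (Module.finrank ℂ (levelSubmodule p m k) : ℝ) := by
            exact_mod_cast hV p m k H₁ H₂ H₃ hkm htpp htest
        _ ≤ _ := finrank_le_gradedBudget _ levelSubmodule_biInv (by linarith)
    have h2 := vol_rpow_le_vol hε1 H₁ H₂ H₃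
    linarith
  · -- top level: the budget is the full one
    rw [budget_of_le hkm] at hlt
    exact htop p m H₁ H₂ H₃ htpp hlt

/-- Restatement (`Iff.rfl`): the conjecture says "no graded (`k < m`) subgroup identity design has
`V > dim F_k`" — the statement the censuses tested and REFUTED at `(2,5,1)` and `(3,2,2)`. -/
theorem volumeLeDimConjecture_iff :
    VolumeLeDimConjecture ↔ ∀ (p : ℕ) [Fact p.Prime] (m k : ℕ) (H₁ H₂ H₃ : Subgroup (GLm p m)), k < m →
      SubgroupTPP H₁ H₂ H₃ → IdTest k H₁ H₂ H₃ →
        Nat.card H₁ * Nat.card H₂ * Nat.card H₃ ≤ Module.finrank ℂ (levelSubmodule p m k) :=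
  Iff.rfl

/-- `dim F_k|_G ≤ |G|` (a submodule of `ℂ^G`). -/
theorem finrank_levelSubmodule_le_card (p m k : ℕ) [Fact p.Prime] :
    Module.finrank ℂ (levelSubmodule p m k) ≤ Nat.card (GLm p m) := by
  calc Module.finrank ℂ (levelSubmodule p m k) ≤ Module.finrank ℂ (GLm p m → ℂ) := Submodule.finrank_le _
    _ = Nat.card (GLm p m) := by rw [Module.finrank_fintype_fun_eq_card, Nat.card_eq_fintype_card]

/-- **`VolumeLeDimConjecture` IS FALSE, given the certified `GL_3(𝔽_2)` configuration.**  Glue: any level-`2`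
subgroup identity configuration in `GL_3(𝔽_2)` whose volume exceeds `|GL_3(𝔽_2)|` refutes the conjecture (since
`dim F_2 ≤ |G|`); `Theorems/SubgroupIdentityDesigns/Negative/VolumeGtDim.lean`
(`exists_levelTwo_idTest_volume_gt_card`, p122039, computational) supplies exactly this hypothesis
(`(S₃, C₄, A₄)`, `V = 288 > 168`). -/
theorem not_volumeLeDimConjecture_of
    (h : ∃ H₁ H₂ H₃ : Subgroup (GLm 2 3), SubgroupTPP H₁ H₂ H₃ ∧ IdTest 2 H₁ H₂ H₃ ∧
      Nat.card (GLm 2 3) < Nat.card H₁ * Nat.card H₂ * Nat.card H₃) :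
    ¬ VolumeLeDimConjecture := by
  intro hV
  obtain ⟨H₁, H₂, H₃, htpp, htest, hlt⟩ := h
  haveI : Fact (Nat.Prime 2) := ⟨Nat.prime_two⟩
  have h1 := hV 2 3 2 H₁ H₂ H₃ (by norm_num) htpp htest
  have h2 := finrank_levelSubmodule_le_card 2 3 2
  omega

end Reduction


/-! ## NearMisses
None recorded yet.  Targets (`payload.targets`): none yet — no line picked; the Borel template of the
only card is dead by `volume_le_card_rankLE_of_le_normalizer` before a skeleton was written. -/

end Summit.MatrixMultiplication.MatrixMultiplication.Cruxes.SubgroupIdentityDesigns.Disproof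

end
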